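import Literature.MathematicalPhysics.QuantumFieldTheory.Balaban1983to89.TorusReflectionPositivity

/-!
# `Balaban1983to89.TorusHypercubicSymmetry` — the point group of the lattice (coordinate permutations and axis
reflections) acts on Bałaban's tori by EXACT symmetries of the torus expectations `Missing.expect`
(kernel bookkeeping for `MISSING.md` §C2a: the inherited, hypercubic part of Euclidean invariance)

CITATION HEADER (lean-in-tree rule 2026-08-18).  Audit cell `pub-balaban`, unit `b2b-balaban-strat` (strategist, gen 5),
deliverable (C) = `MISSING.md` ("OS axioms (reflection positivity survives? Euclidean invariance restoration) … each as a
TYPED open statement").  Nothing of T. Bałaban's series (CMP **95**–**122**, 1984–89) is reproduced or asserted.  Published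
sentences concerned: M. R. Douglas, *Report on the status of the Yang–Mills Millennium Prize Problem* (Clay 2004)
[Douglas2004ClayYM] p. 2: "the resulting expectation values will converge to 'correlation functions in a continuum quantum
field theory,' satisfying formal properties which include invariance under the isometry group of the flat metric on ℝ⁴";
A. Jaffe, E. Witten [JaffeWittenClay2006] §3 p. 5: "Gauge-invariant functions of the quantum fields … transform
covariantly under the Poincaré group" (Euclidean version: the Osterwalder–Schrader axiom of Euclidean invariance).
(v1.2: a clipped quotation of Magnen–Rivasseau–Sénéor CMP **155** (1993) p. 347 stood here in v1–v1.1; in that paper the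
lattice Λ* is the UNIT-scale infrared cutoff and the ultraviolet cutoff is Euclidean invariant — p. 347: "Our ultraviolet
cutoff does not break global SU(2) or Euclidean invariance (small Euclidean breaking effects nevertheless occur due to the
infrared cutoff; for instance in the case of a torus there exist such effects due to the lattice structure of Λ* but they
are tied to the unit scale and do not need counterterms)" — so the sentence is NOT evidence about restoring Euclidean
invariance lost to an ultraviolet LATTICE cutoff, which is the situation on Bałaban's tori; withdrawn as a source here,
cell referee item G-ref2-8 (a).)

WHAT THIS MODULE DOES ([folklore] bookkeeping throughout; companion of `TorusLimitAxioms` §1, which treats the lattice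
TRANSLATIONS, and of `TorusReflectionPositivity`, which treats the Osterwalder–Seiler time reflection).  The isometry
group of the flat torus `ℝ⁴/ℓℤ⁴` is (translations) ⋊ (the hyperoctahedral point group `B₄ = (ℤ/2)⁴ ⋊ S₄` of coordinate
permutations and sign changes).  The lattice approximations `T^{(0)}_K` of `Missing.TorusScheme` are invariant under the
point group EXACTLY, at every `K`; this file types that action on `Setup`'s vocabulary and PROVES the invariance:
§1 coordinate permutations `Site.permute π` and axis reflections `Site.reflect μ` (`x_μ ↦ −x_μ`) of the sites of `T^{(j)}`,
their action on positively oriented bonds (`PBond.permute`, `PBond.reflect` — a reflected `μ`-bond is the image bond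
traversed backwards, exactly as for the time reflection of `TorusReflectionPositivity`) and on plaquettes
(`Plaq.permute` re-orients a plaquette whose directions come out in the wrong order, `Plaq.reflect`), all bijections;
§2 the induced maps on configurations `GaugeField.permute π` / `GaugeField.reflect μ` and the covariance of the plaquette
variables UP TO ORIENTATION (`reTr_plaqHol_permute`, `reTr_plaqHol_reflect`: `Re tr` of a plaquette variable is
insensitive to orientation reversal and conjugation, `GaugeGroup.reTr_inv` / `reTr_conj`), whence invariance of the
Wilson action (`wilsonAction_permute`, `wilsonAction_reflect`); §3 invariance of the product Haar measure (a relabelling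
of the factors, composed — for reflections — with inversion of the reflected-direction variables, `HaarData.map_inv`;
measurability of inversion `[MeasurableInv G]` is the only extra hypothesis) and therefore of the torus expectations:
**`Missing.expect_permute`, `Missing.expect_reflect`** (`⟨F ∘ Φ⟩_{P,β} = ⟨F⟩_{P,β}` for EVERY observable `F` and every
real `β`); §4 covariance of Wilson loops and plaquette variables (`wilsonLoop_permute`, `wilsonLoop_reflect` with the
stepwise image loop); §5 the notion of an exact expectation symmetry `Missing.IsExpectSymmetry` (closed under
composition; translations, permutations, reflections are ones — so every lattice isometry is), the scheme-level
statement `TorusScheme.expectAt_map_eq_of_symmetry` (a relabelling of the observables realised at every step by an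
exact symmetry changes no joint expectation) and its limit form `TorusScheme.limit_symmetry_invariant` via the closed
condition `IsLimitFunctional.map_invariant` of `TorusLimitAxioms`; §6 consistency: the Osterwalder–Seiler site
reflection `GaugeField.negReflect` of `TorusReflectionPositivity` IS the axis reflection `GaugeField.reflect 0`.
UPSHOT FOR THE CENSUS (MISSING.md §C2): a continuum-limit point of the torus expectations inherits invariance under
exactly those isometries of the flat torus that act compatibly on the lattice observables at every `K` (§5:
`TorusScheme.limit_symmetry_invariant`, hypothesis `∀ K`) — and realisation at all LARGE `K` suffices (§8, v1.2:
`TorusScheme.limit_symmetry_invariant_of_eventually`, hypothesis `∀ᶠ K in atTop`, along the strictly increasing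
subsequence of the limit point) —: the `L`-adic translations (`TorusLimitAxioms`; an `L`-adic vector lies in `ε_K ℤ⁴`
only from some `K` on, whence the eventual form) and the full point group `B₄` (this file); invariance under generic
translations and under rotations outside `B₄` ("Euclidean invariance restoration" in the words of the cell contract — Douglas p. 2 prints only
"invariance under the isometry group of the flat metric on ℝ⁴ … Establishing these axioms is the 'existence' part of the problem") has no lattice
counterpart to inherit and stays OPEN (C2a); §9 (v1.3) types the one printed road to it — King's "two sequences of lattices
whose orientations differ by an angle θ₀ incommensurate with 2π" (CMP **103** p. 326): a comparison identity between two
schemes plus UNIQUENESS ACROSS THE TWO SCHEMES gives invariance of the common limit (and, given the comparison, invariance is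
equivalent to agreement of the two limits on the image strings).  Nothing here is progress on any open statement.
-/

noncomputable section

open MeasureTheory Filter Topology
open scoped BigOperators

namespace Literature.MathematicalPhysics.QuantumFieldTheory.Balaban1983to89

/-! ## 1. Coordinate permutations and axis reflections of the sites, bonds and plaquettes of `T^{(j)}` -/

namespace Site

variable {P : Params} {j : ℕ}

/-- Coordinate permutation of sites: `(π·x)_ν = x_{π⁻¹ ν}`, i.e. coordinate `μ` of `x` becomes coordinate `π μ` of `π·x`
(the point-group element of `S_d` acting on the torus `T^{(j)}`). [folklore] -/
def permute (π : Equiv.Perm (Fin P.d)) (x : Site P j) : Site P j := fun ν => x (π.symm ν)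

/-- `permute` evaluated. [folklore] -/
@[simp] theorem permute_apply (π : Equiv.Perm (Fin P.d)) (x : Site P j) (ν : Fin P.d) :
    x.permute π ν = x (π.symm ν) := rfl

/-- The identity permutation acts trivially. [folklore] -/
@[simp] theorem permute_one (x : Site P j) : x.permute 1 = x := rfl

/-- `permute` is a (left) action: `(π σ)·x = π·(σ·x)`. [folklore] -/
theorem permute_mul (π σ : Equiv.Perm (Fin P.d)) (x : Site P j) :
    x.permute (π * σ) = (x.permute σ).permute π := by
  funext ν
  simp [permute, Equiv.Perm.mul_def]

/-- Permuting coordinates carries the unit step in direction `μ` to the unit step in direction `π μ`. [folklore] -/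
theorem shift_permute (π : Equiv.Perm (Fin P.d)) (x : Site P j) (μ : Fin P.d) :
    (x.shift μ).permute π = (x.permute π).shift (π μ) := by
  funext ν
  by_cases h : ν = π μ
  · subst h
    simp [Site.shift, permute]
  · have h' : π.symm ν ≠ μ := fun h'' => h (by rw [← h'', Equiv.apply_symm_apply])
    simp [Site.shift, permute, Function.update_of_ne h, Function.update_of_ne h']

/-- Reflection of the `μ`-th axis: `(r_μ x)_μ = −x_μ`, the other coordinates unchanged (a generator of the sign-change
subgroup `(ℤ/2)^d` of the point group). [folklore] -/
def reflect (μ : Fin P.d) (x : Site P j) : Site P j := Function.update x μ (-x μ)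

/-- The unit step evaluated coordinatewise. [folklore] -/
theorem shift_apply (x : Site P j) (μ ν : Fin P.d) : x.shift μ ν = if ν = μ then x μ + 1 else x ν := by
  simp only [Site.shift, Function.update_apply]

/-- The backward unit step evaluated coordinatewise. [folklore] -/
theorem unshift_apply (x : Site P j) (μ ν : Fin P.d) : x.unshift μ ν = if ν = μ then x μ - 1 else x ν := by
  simp only [Site.unshift, Function.update_apply]

/-- The reflection evaluated coordinatewise. [folklore] -/
theorem reflect_apply (μ : Fin P.d) (x : Site P j) (ν : Fin P.d) :
    x.reflect μ ν = if ν = μ then -x μ else x ν := by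
  simp only [reflect, Function.update_apply]

/-- An axis reflection is an involution. [folklore] -/
@[simp] theorem reflect_reflect (μ : Fin P.d) (x : Site P j) : (x.reflect μ).reflect μ = x := by
  funext ν
  simp only [reflect_apply]
  split_ifs with h
  · subst h; simp
  · rfl

/-- Reflection of the `μ`-th axis commutes with steps in the other directions. [folklore] -/
theorem shift_reflect_of_ne (μ : Fin P.d) (x : Site P j) {ν : Fin P.d} (h : ν ≠ μ) :
    (x.shift ν).reflect μ = (x.reflect μ).shift ν := by
  funext κ
  simp only [reflect_apply, shift_apply]
  split_ifs with h1 h2 <;> subst_vars <;> simp_all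

/-- Unit steps in different directions commute. [folklore] -/
theorem shift_comm (x : Site P j) (μ ν : Fin P.d) : (x.shift μ).shift ν = (x.shift ν).shift μ := by
  funext κ
  simp only [shift_apply]
  split_ifs with h1 h2 <;> subst_vars <;> simp_all

/-- `r_μ (x + e_μ) + e_μ = r_μ x`: the reflected forward step is the backward step. [folklore] -/
theorem shift_reflect_shift (μ : Fin P.d) (x : Site P j) : ((x.shift μ).reflect μ).shift μ = x.reflect μ := by
  funext κ
  by_cases h : κ = μ
  · subst h
    simp only [Site.shift, reflect, Function.update_self]
    ring
  · simp only [Site.shift, reflect, Function.update_of_ne h]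

/-- `r_μ (r_μ (x + e_μ) + e_μ) = x`. [folklore] -/
theorem reflect_shift_reflect_shift (μ : Fin P.d) (x : Site P j) :
    (((x.shift μ).reflect μ).shift μ).reflect μ = x := by
  rw [shift_reflect_shift, reflect_reflect]

/-- `r_μ (x + e_μ) = r_μ x − e_μ`. [folklore] -/
theorem shift_reflect_self (μ : Fin P.d) (x : Site P j) : (x.shift μ).reflect μ = (x.reflect μ).unshift μ := by
  funext κ
  by_cases h : κ = μ
  · subst h
    simp only [Site.shift, Site.unshift, reflect, Function.update_self]
    ring
  · simp only [Site.shift, Site.unshift, reflect, Function.update_of_ne h]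

end Site

namespace PBond

variable {P : Params} {j : ℕ}

/-- The permuted bond `⟨π·x, π μ⟩` (positively oriented bonds go to positively oriented bonds). [folklore] -/
def permute (π : Equiv.Perm (Fin P.d)) (b : PBond P j) : PBond P j := ⟨b.src.permute π, π b.dir⟩

/-- Source of a permuted bond. [folklore] -/
@[simp] theorem permute_src (π : Equiv.Perm (Fin P.d)) (b : PBond P j) : (b.permute π).src = b.src.permute π := rfl

/-- Direction of a permuted bond. [folklore] -/
@[simp] theorem permute_dir (π : Equiv.Perm (Fin P.d)) (b : PBond P j) : (b.permute π).dir = π b.dir := rfl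

/-- `permute` on bonds is an action. [folklore] -/
theorem permute_permute (π σ : Equiv.Perm (Fin P.d)) (b : PBond P j) :
    (b.permute σ).permute π = b.permute (π * σ) := by
  cases b
  simp [permute, Site.permute_mul, Equiv.Perm.mul_apply]

/-- The identity permutation acts trivially on bonds. [folklore] -/
@[simp] theorem permute_one (b : PBond P j) : b.permute 1 = b := by
  cases b
  simp [permute]

/-- Coordinate permutation of bonds by `π` is a bijection (inverse: by `π⁻¹`). [folklore] -/
def permuteEquiv (π : Equiv.Perm (Fin P.d)) : PBond P j ≃ PBond P j where
  toFun := permute π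
  invFun := permute π⁻¹
  left_inv b := by
    show (b.permute π).permute π⁻¹ = b
    rw [permute_permute, inv_mul_cancel, permute_one]
  right_inv b := by
    show (b.permute π⁻¹).permute π = b
    rw [permute_permute, mul_inv_cancel, permute_one]

/-- The reflected bond `r_μ b`: a bond in a direction `ν ≠ μ` goes to `⟨r_μ x, ν⟩`; the `μ`-bond `⟨x, μ⟩` (from `x` to
`x + e_μ`) goes to the positively oriented bond from `r_μ(x + e_μ) = r_μ x − e_μ` to `r_μ x`, which the reflected path
traverses BACKWARDS (cf. `PBond.siteReflect` of `TorusReflectionPositivity`, the case `μ = 0`). [folklore] -/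
def reflect (μ : Fin P.d) (b : PBond P j) : PBond P j :=
  ⟨if b.dir = μ then (b.src.shift μ).reflect μ else b.src.reflect μ, b.dir⟩

/-- The bond reflection preserves directions. [folklore] -/
@[simp] theorem reflect_dir (μ : Fin P.d) (b : PBond P j) : (b.reflect μ).dir = b.dir := rfl

/-- Source of the reflection of a `μ`-bond. [folklore] -/
theorem reflect_src_of_eq (μ : Fin P.d) (b : PBond P j) (h : b.dir = μ) :
    (b.reflect μ).src = (b.src.shift μ).reflect μ := by
  simp [reflect, h]

/-- Source of the reflection of a bond in another direction. [folklore] -/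
theorem reflect_src_of_ne (μ : Fin P.d) (b : PBond P j) (h : b.dir ≠ μ) : (b.reflect μ).src = b.src.reflect μ := by
  simp [reflect, h]

/-- The bond reflection is an involution. [folklore] -/
@[simp] theorem reflect_reflect (μ : Fin P.d) (b : PBond P j) : (b.reflect μ).reflect μ = b := by
  obtain ⟨x, ν⟩ := b
  by_cases h : ν = μ
  · subst h
    simp [reflect, Site.reflect_shift_reflect_shift]
  · simp [reflect, h]

/-- The bond reflection as a bijection of the bonds. [folklore] -/
def reflectEquiv (μ : Fin P.d) : PBond P j ≃ PBond P j :=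
  Function.Involutive.toPerm (reflect μ) (reflect_reflect μ)

end PBond

namespace Plaq

variable {P : Params} {j : ℕ}

/-- The positively oriented plaquette at `x` spanned by two distinct directions `a ≠ b`, whichever their order. [folklore] -/
def mkOrdered (x : Site P j) (a b : Fin P.d) (h : a ≠ b) : Plaq P j :=
  if hab : a < b then ⟨x, a, b, hab⟩ else ⟨x, b, a, lt_of_le_of_ne (not_lt.mp hab) h.symm⟩

/-- Base point of `mkOrdered`. [folklore] -/
@[simp] theorem mkOrdered_src (x : Site P j) (a b : Fin P.d) (h : a ≠ b) : (mkOrdered x a b h).src = x := by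
  unfold mkOrdered
  split_ifs <;> rfl

/-- First direction of `mkOrdered` = the smaller one. [folklore] -/
theorem mkOrdered_μ (x : Site P j) (a b : Fin P.d) (h : a ≠ b) : (mkOrdered x a b h).μ = min a b := by
  unfold mkOrdered
  split_ifs with hab
  · exact (min_eq_left hab.le).symm
  · exact (min_eq_right (not_lt.mp hab)).symm

/-- Second direction of `mkOrdered` = the larger one. [folklore] -/
theorem mkOrdered_ν (x : Site P j) (a b : Fin P.d) (h : a ≠ b) : (mkOrdered x a b h).ν = max a b := by
  unfold mkOrdered
  split_ifs with hab
  · exact (max_eq_right hab.le).symm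
  · exact (max_eq_left (not_lt.mp hab)).symm

/-- Plaquettes with the same base point and directions are equal. [folklore] -/
theorem ext' {p q : Plaq P j} (hs : p.src = q.src) (hμ : p.μ = q.μ) (hν : p.ν = q.ν) : p = q := by
  cases p; cases q
  simp only at hs hμ hν
  subst hs; subst hμ; subst hν
  rfl

/-- `mkOrdered` does not depend on the order of the two directions. [folklore] -/
theorem mkOrdered_swap (x : Site P j) (a b : Fin P.d) (h : a ≠ b) : mkOrdered x b a h.symm = mkOrdered x a b h :=
  ext' (by simp) (by rw [mkOrdered_μ, mkOrdered_μ, min_comm]) (by rw [mkOrdered_ν, mkOrdered_ν, max_comm])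

/-- A plaquette is `mkOrdered` of its own data. [folklore] -/
theorem mkOrdered_self (p : Plaq P j) : mkOrdered p.src p.μ p.ν p.hμν.ne = p := by
  unfold mkOrdered
  rw [dif_pos p.hμν]

/-- The permuted plaquette: base point `π·x`, directions `{π μ, π ν}` RE-ORDERED increasingly (when `π ν < π μ` the image
square is the positively oriented plaquette `⟨π·x, π ν, π μ⟩` traversed in the opposite sense). [folklore] -/
def permute (π : Equiv.Perm (Fin P.d)) (p : Plaq P j) : Plaq P j :=
  mkOrdered (p.src.permute π) (π p.μ) (π p.ν) (π.injective.ne p.hμν.ne)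

/-- Base point of the permuted plaquette. [folklore] -/
@[simp] theorem permute_src (π : Equiv.Perm (Fin P.d)) (p : Plaq P j) : (p.permute π).src = p.src.permute π := by
  simp [permute]

/-- First direction of the permuted plaquette. [folklore] -/
theorem permute_μ (π : Equiv.Perm (Fin P.d)) (p : Plaq P j) : (p.permute π).μ = min (π p.μ) (π p.ν) := by
  rw [permute, mkOrdered_μ]

/-- Second direction of the permuted plaquette. [folklore] -/
theorem permute_ν (π : Equiv.Perm (Fin P.d)) (p : Plaq P j) : (p.permute π).ν = max (π p.μ) (π p.ν) := by
  rw [permute, mkOrdered_ν]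

/-- `permute` on plaquettes is an action. [folklore] -/
theorem permute_permute (π σ : Equiv.Perm (Fin P.d)) (p : Plaq P j) :
    (p.permute σ).permute π = p.permute (π * σ) := by
  refine ext' ?_ ?_ ?_
  · simp [Site.permute_mul]
  · simp only [permute_μ, permute_ν, Equiv.Perm.mul_apply]
    rcases le_total (σ p.μ) (σ p.ν) with h | h
    · rw [min_eq_left h, max_eq_right h]
    · rw [min_eq_right h, max_eq_left h, min_comm]
  · simp only [permute_μ, permute_ν, Equiv.Perm.mul_apply]
    rcases le_total (σ p.μ) (σ p.ν) with h | h
    · rw [min_eq_left h, max_eq_right h]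
    · rw [min_eq_right h, max_eq_left h, max_comm]

/-- The identity permutation acts trivially on plaquettes. [folklore] -/
@[simp] theorem permute_one (p : Plaq P j) : p.permute 1 = p :=
  ext' (by simp) (by rw [permute_μ, Equiv.Perm.one_apply, Equiv.Perm.one_apply, min_eq_left p.hμν.le])
    (by rw [permute_ν, Equiv.Perm.one_apply, Equiv.Perm.one_apply, max_eq_right p.hμν.le])

/-- Coordinate permutation of plaquettes by `π` is a bijection (inverse: by `π⁻¹`). [folklore] -/
def permuteEquiv (π : Equiv.Perm (Fin P.d)) : Plaq P j ≃ Plaq P j where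
  toFun := permute π
  invFun := permute π⁻¹
  left_inv p := by
    show (p.permute π).permute π⁻¹ = p
    rw [permute_permute, inv_mul_cancel, permute_one]
  right_inv p := by
    show (p.permute π⁻¹).permute π = p
    rw [permute_permute, mul_inv_cancel, permute_one]

/-- The reflected plaquette `r_μ p`: same directions; base point `r_μ x` if `μ` is not one of its directions, else
`r_μ x − e_μ` (the image square then hangs on the negative side of `r_μ x` in direction `μ`). [folklore] -/
def reflect (μ : Fin P.d) (p : Plaq P j) : Plaq P j :=
  ⟨if p.μ = μ ∨ p.ν = μ then (p.src.shift μ).reflect μ else p.src.reflect μ, p.μ, p.ν, p.hμν⟩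

/-- The plaquette reflection is an involution. [folklore] -/
@[simp] theorem reflect_reflect (μ : Fin P.d) (p : Plaq P j) : (p.reflect μ).reflect μ = p := by
  obtain ⟨x, a, b, hab⟩ := p
  simp only [reflect]
  split_ifs with h
  · simp [Site.reflect_shift_reflect_shift]
  · simp

/-- The plaquette reflection as a bijection of the plaquettes. [folklore] -/
def reflectEquiv (μ : Fin P.d) : Plaq P j ≃ Plaq P j :=
  Function.Involutive.toPerm (reflect μ) (reflect_reflect μ)

end Plaq

/-! ## 2. The induced maps on configurations; plaquette variables up to orientation; invariance of the Wilson action -/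

namespace GaugeField

variable {P : Params} {j : ℕ} {G : Type*}

/-- The permuted configuration `(π·U)(b) = U(π·b)` (pull-back along the bond permutation). [folklore] -/
def permute (π : Equiv.Perm (Fin P.d)) (U : GaugeField P j G) : GaugeField P j G := fun b => U (b.permute π)

/-- `permute` evaluated. [folklore] -/
@[simp] theorem permute_apply (π : Equiv.Perm (Fin P.d)) (U : GaugeField P j G) (b : PBond P j) :
    U.permute π b = U (b.permute π) := rfl

/-- Composition of coordinate permutations on configurations (contravariant: pull-backs). [folklore] -/
theorem permute_permute (π σ : Equiv.Perm (Fin P.d)) (U : GaugeField P j G) :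
    (U.permute π).permute σ = U.permute (π * σ) := by
  funext b
  simp [PBond.permute_permute]

/-- The identity permutation acts trivially on configurations. [folklore] -/
@[simp] theorem permute_one (U : GaugeField P j G) : U.permute 1 = U := by
  funext b
  simp

variable [GaugeGroup G]

/-- The reflected configuration `r_μ U`: on a bond `b` in a direction `≠ μ` it is `U(r_μ b)`; on a `μ`-bond it is
`U(r_μ b)⁻¹` — the reflected `μ`-bond is traversed backwards (`U(y, x) = U(x, y)⁻¹`). [folklore] -/
def reflect (μ : Fin P.d) (U : GaugeField P j G) : GaugeField P j G :=
  fun b => if b.dir = μ then (U (b.reflect μ))⁻¹ else U (b.reflect μ)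

/-- `reflect` evaluated. [folklore] -/
theorem reflect_apply (μ : Fin P.d) (U : GaugeField P j G) (b : PBond P j) :
    U.reflect μ b = if b.dir = μ then (U (b.reflect μ))⁻¹ else U (b.reflect μ) := rfl

/-- The reflection of configurations is an involution. [folklore] -/
@[simp] theorem reflect_reflect (μ : Fin P.d) (U : GaugeField P j G) : (U.reflect μ).reflect μ = U := by
  funext b
  simp only [reflect_apply, PBond.reflect_dir]
  split_ifs with h
  · rw [PBond.reflect_reflect, inv_inv]
  · rw [PBond.reflect_reflect]

/-! ### Plaquette variables up to orientation -/

/-- The holonomy around the elementary square at `x` spanned by the ORDERED pair of directions `(a, b)`: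
`U(x,x+e_a) U(x+e_a,x+e_a+e_b) U(x+e_b,x+e_a+e_b)⁻¹ U(x,x+e_b)⁻¹`; for `a < b` this is `plaqHol U ⟨x, a, b⟩` (B7 (9)),
for `b < a` the same square traversed in the opposite sense. [cite: Balaban1985Averaging, (9) p.19] -/
def holAt (U : GaugeField P j G) (x : Site P j) (a b : Fin P.d) : G :=
  U ⟨x, a⟩ * U ⟨x.shift a, b⟩ * (U ⟨x.shift b, a⟩)⁻¹ * (U ⟨x, b⟩)⁻¹

/-- `plaqHol` is `holAt` at the plaquette's data. [folklore] -/
theorem plaqHol_eq_holAt (U : GaugeField P j G) (p : Plaq P j) : plaqHol U p = holAt U p.src p.μ p.ν := rfl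

/-- Reversing the orientation inverts the holonomy. [folklore] -/
theorem holAt_swap (U : GaugeField P j G) (x : Site P j) (a b : Fin P.d) : holAt U x b a = (holAt U x a b)⁻¹ := by
  simp only [holAt, mul_inv_rev, inv_inv, mul_assoc]

/-- `Re tr` of a plaquette variable does not see the orientation (`reTr g⁻¹ = reTr g`). [folklore] -/
theorem reTr_holAt_swap (U : GaugeField P j G) (x : Site P j) (a b : Fin P.d) :
    reTr (holAt U x b a) = reTr (holAt U x a b) := by
  rw [holAt_swap, GaugeGroup.reTr_inv]

/-- `Re tr` of the plaquette variable of `mkOrdered x a b` is `Re tr` of the oriented holonomy `holAt U x a b`. [folklore] -/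
theorem reTr_plaqHol_mkOrdered (U : GaugeField P j G) (x : Site P j) (a b : Fin P.d) (h : a ≠ b) :
    reTr (plaqHol U (Plaq.mkOrdered x a b h)) = reTr (holAt U x a b) := by
  unfold Plaq.mkOrdered
  split_ifs with hab
  · rfl
  · exact reTr_holAt_swap U x a b

/-- Oriented holonomies of a permuted configuration are oriented holonomies of the configuration at the permuted data. [folklore] -/
theorem holAt_permute (π : Equiv.Perm (Fin P.d)) (U : GaugeField P j G) (x : Site P j) (a b : Fin P.d) :
    holAt (U.permute π) x a b = holAt U (x.permute π) (π a) (π b) := by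
  simp [holAt, PBond.permute, Site.shift_permute]

/-- **Plaquette variables are permutation covariant up to orientation**: `Re tr (π·U)(∂p) = Re tr U(∂(π·p))`. [folklore] -/
theorem reTr_plaqHol_permute (π : Equiv.Perm (Fin P.d)) (U : GaugeField P j G) (p : Plaq P j) :
    reTr (plaqHol (U.permute π) p) = reTr (plaqHol U (p.permute π)) := by
  rw [plaqHol_eq_holAt, holAt_permute, Plaq.permute, reTr_plaqHol_mkOrdered]

/-- `Re tr (g₁⁻¹ g₄ g₃ g₂⁻¹) = Re tr (g₁ g₂ g₃⁻¹ g₄⁻¹)` (a conjugate of the inverse). [folklore] -/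
theorem reTr_pattern₁ (g₁ g₂ g₃ g₄ : G) : reTr (g₁⁻¹ * g₄ * g₃ * g₂⁻¹) = reTr (g₁ * g₂ * g₃⁻¹ * g₄⁻¹) := by
  have h : g₁⁻¹ * g₄ * g₃ * g₂⁻¹ = g₁⁻¹ * (g₁ * g₂ * g₃⁻¹ * g₄⁻¹)⁻¹ * g₁⁻¹⁻¹ := by group
  rw [h, GaugeGroup.reTr_conj, GaugeGroup.reTr_inv]

/-- `Re tr (g₃ g₂⁻¹ g₁⁻¹ g₄) = Re tr (g₁ g₂ g₃⁻¹ g₄⁻¹)` (a conjugate of the inverse). [folklore] -/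
theorem reTr_pattern₂ (g₁ g₂ g₃ g₄ : G) : reTr (g₃ * g₂⁻¹ * g₁⁻¹ * g₄) = reTr (g₁ * g₂ * g₃⁻¹ * g₄⁻¹) := by
  have h : g₃ * g₂⁻¹ * g₁⁻¹ * g₄ = g₄⁻¹ * (g₁ * g₂ * g₃⁻¹ * g₄⁻¹)⁻¹ * g₄⁻¹⁻¹ := by group
  rw [h, GaugeGroup.reTr_conj, GaugeGroup.reTr_inv]

/-- **Plaquette variables are reflection covariant up to orientation and conjugation**:
`Re tr (r_μ U)(∂p) = Re tr U(∂(r_μ p))` (for `μ` a direction of `p` the image square is traversed in the opposite sense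
from another corner — a conjugate of the inverse, invisible to `Re tr`). [folklore] -/
theorem reTr_plaqHol_reflect (μ : Fin P.d) (U : GaugeField P j G) (p : Plaq P j) :
    reTr (plaqHol (U.reflect μ) p) = reTr (plaqHol U (p.reflect μ)) := by
  obtain ⟨x, a, b, hab⟩ := p
  simp only [plaqHol_eq_holAt, Plaq.reflect]
  by_cases ha : a = μ
  · subst ha
    rw [if_pos (Or.inl rfl)]
    have hb : b ≠ a := hab.ne'
    have e1 : U.reflect a ⟨x, a⟩ = (U ⟨(x.shift a).reflect a, a⟩)⁻¹ := by
      simp [reflect_apply, PBond.reflect]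
    have e2 : U.reflect a ⟨x.shift a, b⟩ = U ⟨(x.shift a).reflect a, b⟩ := by
      simp [reflect_apply, PBond.reflect, hb]
    have e3 : U.reflect a ⟨x.shift b, a⟩ = (U ⟨((x.shift a).reflect a).shift b, a⟩)⁻¹ := by
      simp [reflect_apply, PBond.reflect, Site.shift_comm x b a, Site.shift_reflect_of_ne a _ hb]
    have e4 : U.reflect a ⟨x, b⟩ = U ⟨((x.shift a).reflect a).shift a, b⟩ := by
      simp [reflect_apply, PBond.reflect, hb, Site.shift_reflect_shift]
    simp only [holAt, e1, e2, e3, e4, inv_inv]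
    exact reTr_pattern₁ _ _ _ _
  · by_cases hb : b = μ
    · subst hb
      rw [if_pos (Or.inr rfl)]
      have e1 : U.reflect b ⟨x, a⟩ = U ⟨((x.shift b).reflect b).shift b, a⟩ := by
        simp [reflect_apply, PBond.reflect, ha, Site.shift_reflect_shift]
      have e2 : U.reflect b ⟨x.shift a, b⟩ = (U ⟨((x.shift b).reflect b).shift a, b⟩)⁻¹ := by
        simp [reflect_apply, PBond.reflect, Site.shift_comm x a b, Site.shift_reflect_of_ne b _ ha]
      have e3 : U.reflect b ⟨x.shift b, a⟩ = U ⟨(x.shift b).reflect b, a⟩ := by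
        simp [reflect_apply, PBond.reflect, ha]
      have e4 : U.reflect b ⟨x, b⟩ = (U ⟨(x.shift b).reflect b, b⟩)⁻¹ := by
        simp [reflect_apply, PBond.reflect]
      simp only [holAt, e1, e2, e3, e4, inv_inv]
      exact reTr_pattern₂ _ _ _ _
    · rw [if_neg (not_or.mpr ⟨ha, hb⟩)]
      congr 1
      simp [holAt, reflect_apply, PBond.reflect, ha, hb, Site.shift_reflect_of_ne μ _ ha,
        Site.shift_reflect_of_ne μ _ hb]

/-! ### The Wilson action -/

/-- **The Wilson action is invariant under coordinate permutations**: `A(π·U) = A(U)` (re-index the sum over plaquettes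
by `p ↦ π·p`; orientation is invisible to `Re tr`). [folklore] -/
theorem wilsonAction_permute (w : ℝ) (π : Equiv.Perm (Fin P.d)) (U : GaugeField P j G) :
    wilsonAction w (U.permute π) = wilsonAction w U := by
  unfold wilsonAction
  simp_rw [reTr_plaqHol_permute]
  exact Fintype.sum_equiv (Plaq.permuteEquiv π) _ _ fun p => rfl

/-- **The Wilson action is invariant under axis reflections**: `A(r_μ U) = A(U)`. [folklore] -/
theorem wilsonAction_reflect (w : ℝ) (μ : Fin P.d) (U : GaugeField P j G) :
    wilsonAction w (U.reflect μ) = wilsonAction w U := by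
  unfold wilsonAction
  simp_rw [reTr_plaqHol_reflect]
  exact Fintype.sum_equiv (Plaq.reflectEquiv μ) _ _ fun p => rfl

/-- `A(π·U) = A(U)` for the `d = 4` Wilson action of `Setup`. [folklore] -/
theorem wilsonAction4_permute (π : Equiv.Perm (Fin P.d)) (U : GaugeField P j G) :
    wilsonAction4 (U.permute π) = wilsonAction4 U :=
  wilsonAction_permute 1 π U

/-- `A(r_μ U) = A(U)` for the `d = 4` Wilson action of `Setup`. [folklore] -/
theorem wilsonAction4_reflect (μ : Fin P.d) (U : GaugeField P j G) :
    wilsonAction4 (U.reflect μ) = wilsonAction4 U :=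
  wilsonAction_reflect 1 μ U

/-! ## 3. Invariance of the product Haar measure and of the torus expectations -/

section Measure

variable [MeasurableSpace G] [HaarData G]

omit [GaugeGroup G] [HaarData G] in
/-- `U ↦ π·U` is the coordinate relabelling `(MeasurableEquiv.piCongrLeft _ (PBond.permuteEquiv π)).symm`. [folklore] -/
theorem piCongrLeft_permuteEquiv_symm_apply (π : Equiv.Perm (Fin P.d)) (U : GaugeField P j G) :
    (MeasurableEquiv.piCongrLeft (fun _ : PBond P j => G) (PBond.permuteEquiv π)).symm U = U.permute π := by
  funext b
  rfl

/-- **The product Haar measure is invariant under coordinate permutations** (a permutation of identical factors). [folklore] -/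
theorem measurePreserving_permute (π : Equiv.Perm (Fin P.d)) :
    MeasurePreserving (permute (G := G) π) (fieldMeasure P j G) (fieldMeasure P j G) := by
  haveI : IsProbabilityMeasure (HaarData.haar (G := G)) := HaarData.isProb
  have h := (measurePreserving_piCongrLeft (fun _ : PBond P j => (HaarData.haar : Measure G))
    (PBond.permuteEquiv π)).symm _
  have hcoe : ⇑(MeasurableEquiv.piCongrLeft (fun _ : PBond P j => G) (PBond.permuteEquiv π)).symm =
      permute (G := G) π := funext (piCongrLeft_permuteEquiv_symm_apply π)
  rw [hcoe] at h
  exact h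

/-- Change of variables `U ↦ π·U`: `∫ g(π·U) dU = ∫ g(U) dU`. [folklore] -/
theorem integral_comp_permute (π : Equiv.Perm (Fin P.d)) (g : GaugeField P j G → ℝ) :
    ∫ U, g (U.permute π) ∂fieldMeasure P j G = ∫ U, g U ∂fieldMeasure P j G := by
  haveI : IsProbabilityMeasure (HaarData.haar (G := G)) := HaarData.isProb
  have h := ((measurePreserving_piCongrLeft (fun _ : PBond P j => (HaarData.haar : Measure G))
    (PBond.permuteEquiv π)).symm _).integral_comp' g
  simp_rw [piCongrLeft_permuteEquiv_symm_apply] at h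
  exact h

variable [MeasurableInv G]

omit [MeasurableSpace G] [HaarData G] [MeasurableInv G] in
/-- `r_μ` on configurations = (invert the `μ`-bond variables) ∘ (relabel the bonds by the involution `r_μ`). [folklore] -/
theorem reflect_eq_comp (μ : Fin P.d) :
    reflect (P := P) (j := j) (G := G) μ =
      (fun (V : GaugeField P j G) (b : PBond P j) => (if b.dir = μ then (fun g : G => g⁻¹) else id) (V b)) ∘
        fun (U : GaugeField P j G) (b : PBond P j) => U (b.reflect μ) := by
  funext U b
  simp only [Function.comp_apply, reflect_apply]
  split_ifs <;> rfl

/-- **The product Haar measure is invariant under axis reflections** (relabelling of the factors by an involution, then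
inversion of the reflected-direction variables — Haar measure is inversion invariant, `HaarData.map_inv`; measurability of
inversion is the hypothesis `[MeasurableInv G]`). [folklore] -/
theorem measurePreserving_reflect (μ : Fin P.d) :
    MeasurePreserving (reflect (G := G) μ) (fieldMeasure P j G) (fieldMeasure P j G) := by
  haveI : IsProbabilityMeasure (HaarData.haar (G := G)) := HaarData.isProb
  have h1 : MeasurePreserving (fun (U : GaugeField P j G) (b : PBond P j) => U (b.reflect μ))
      (fieldMeasure P j G) (fieldMeasure P j G) := by
    have h := (measurePreserving_piCongrLeft (fun _ : PBond P j => (HaarData.haar : Measure G))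
      (PBond.reflectEquiv (P := P) (j := j) μ)).symm _
    have hcoe : ⇑(MeasurableEquiv.piCongrLeft (fun _ : PBond P j => G) (PBond.reflectEquiv μ)).symm =
        fun (U : GaugeField P j G) (b : PBond P j) => U (b.reflect μ) := by
      funext U b
      rfl
    rw [hcoe] at h
    exact h
  have h2 : MeasurePreserving
      (fun (V : GaugeField P j G) (b : PBond P j) => (if b.dir = μ then (fun g : G => g⁻¹) else id) (V b))
      (fieldMeasure P j G) (fieldMeasure P j G) := by
    unfold fieldMeasure
    refine measurePreserving_pi _ _ fun b => ?_
    split_ifs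
    · exact ⟨measurable_inv, HaarData.map_inv⟩
    · exact MeasurePreserving.id _
  rw [reflect_eq_comp]
  exact h2.comp h1

/-- `r_μ` is measurable on configurations. [folklore] -/
theorem measurable_reflect (μ : Fin P.d) : Measurable (reflect (P := P) (j := j) (G := G) μ) :=
  (measurePreserving_reflect μ).measurable

/-- `r_μ` as a measurable involution of configuration space. [folklore] -/
def reflectMEquiv (μ : Fin P.d) : GaugeField P j G ≃ᵐ GaugeField P j G where
  toFun := reflect μ
  invFun := reflect μ
  left_inv := reflect_reflect μ
  right_inv := reflect_reflect μ
  measurable_toFun := measurable_reflect μ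
  measurable_invFun := measurable_reflect μ

/-- Change of variables `U ↦ r_μ U`: `∫ g(r_μ U) dU = ∫ g(U) dU`. [folklore] -/
theorem integral_comp_reflect (μ : Fin P.d) (g : GaugeField P j G → ℝ) :
    ∫ U, g (U.reflect μ) ∂fieldMeasure P j G = ∫ U, g U ∂fieldMeasure P j G := by
  have h : MeasurePreserving (reflectMEquiv (P := P) (j := j) (G := G) μ) (fieldMeasure P j G) (fieldMeasure P j G) :=
    measurePreserving_reflect μ
  exact h.integral_comp' g

end Measure

end GaugeField

namespace Missing

/-! ### Torus expectations, loop and plaquette variables under the point group -/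

section PointGroup

variable {P : Params} {G : Type*} [GaugeGroup G]

/-- The permuted path step (same orientation, bond permuted). [folklore] -/
def PathStep.permute (π : Equiv.Perm (Fin P.d)) (s : PathStep P) : PathStep P := ⟨s.bond.permute π, s.fwd⟩

/-- Holonomy of a permuted configuration along `γ` = holonomy of the configuration along `π·γ`. [folklore] -/
theorem pathHol_permute (π : Equiv.Perm (Fin P.d)) (U : GaugeField P 0 G) (γ : List (PathStep P)) :
    pathHol (U.permute π) γ = pathHol U (γ.map (PathStep.permute π)) := by
  simp only [pathHol, List.map_map]
  rfl

/-- **Wilson loops are permutation covariant**: `W_γ(π·U) = W_{π·γ}(U)`. [folklore] -/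
theorem wilsonLoop_permute (π : Equiv.Perm (Fin P.d)) (U : GaugeField P 0 G) (γ : List (PathStep P)) :
    wilsonLoop (U.permute π) γ = wilsonLoop U (γ.map (PathStep.permute π)) := by
  rw [wilsonLoop, wilsonLoop, pathHol_permute]

/-- Plaquette variables are permutation covariant: `Re tr (π·U)(∂p) = Re tr U(∂(π·p))`. [folklore] -/
theorem plaqLoop_permute (π : Equiv.Perm (Fin P.d)) (p : Plaq P 0) (U : GaugeField P 0 G) :
    plaqLoop p (U.permute π) = plaqLoop (p.permute π) U := by
  rw [plaqLoop, plaqLoop, GaugeField.reTr_plaqHol_permute]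

/-- The reflected path step: the bond is reflected; a step in the reflected direction `μ` changes orientation (the
reflected `μ`-bond points backwards), a step in another direction keeps it. [folklore] -/
def PathStep.reflect (μ : Fin P.d) (s : PathStep P) : PathStep P :=
  ⟨s.bond.reflect μ, if s.bond.dir = μ then !s.fwd else s.fwd⟩

/-- Step variables under `r_μ`: the step variable of `s` in `r_μ U` is the step variable of `r_μ s` in `U`. [folklore] -/
theorem stepHol_reflect (μ : Fin P.d) (U : GaugeField P 0 G) (s : PathStep P) :
    (if s.fwd then U.reflect μ s.bond else (U.reflect μ s.bond)⁻¹) =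
      (if (s.reflect μ).fwd then U (s.reflect μ).bond else (U (s.reflect μ).bond)⁻¹) := by
  simp only [PathStep.reflect, GaugeField.reflect_apply]
  by_cases hd : s.bond.dir = μ <;> cases s.fwd <;> simp [hd]

/-- **Wilson loops are reflection covariant**: `W_γ(r_μ U) = W_{r_μ γ}(U)`, `r_μ γ` the stepwise reflected loop. [folklore] -/
theorem wilsonLoop_reflect (μ : Fin P.d) (U : GaugeField P 0 G) (γ : List (PathStep P)) :
    wilsonLoop (U.reflect μ) γ = wilsonLoop U (γ.map (PathStep.reflect μ)) := by
  unfold wilsonLoop pathHol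
  rw [List.map_map]
  congr 2
  exact List.map_congr_left fun s _ => stepHol_reflect μ U s

/-- Plaquette variables are reflection covariant: `Re tr (r_μ U)(∂p) = Re tr U(∂(r_μ p))`. [folklore] -/
theorem plaqLoop_reflect (μ : Fin P.d) (p : Plaq P 0) (U : GaugeField P 0 G) :
    plaqLoop p (U.reflect μ) = plaqLoop (p.reflect μ) U := by
  rw [plaqLoop, plaqLoop, GaugeField.reTr_plaqHol_reflect]

omit [GaugeGroup G] in
/-- Permuting a path step twice composes the permutations. [folklore] -/
theorem PathStep.permute_permute (π σ : Equiv.Perm (Fin P.d)) (s : PathStep P) :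
    (s.permute σ).permute π = s.permute (π * σ) := by
  simp [PathStep.permute, PBond.permute_permute]

omit [GaugeGroup G] in
/-- The step reflection is an involution. [folklore] -/
@[simp] theorem PathStep.reflect_reflect (μ : Fin P.d) (s : PathStep P) : (s.reflect μ).reflect μ = s := by
  obtain ⟨b, f⟩ := s
  simp only [PathStep.reflect, PBond.reflect_dir, PBond.reflect_reflect]
  by_cases hd : b.dir = μ <;> simp [hd]

omit [GaugeGroup G] in
/-- Reflecting a loop twice gives it back. [folklore] -/
theorem map_reflect_map_reflect (μ : Fin P.d) (γ : List (PathStep P)) :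
    (γ.map (PathStep.reflect μ)).map (PathStep.reflect μ) = γ := by
  rw [List.map_map]
  conv_rhs => rw [← List.map_id γ]
  exact List.map_congr_left fun s _ => PathStep.reflect_reflect μ s

/-- The Boltzmann weight is invariant under coordinate permutations. [folklore] -/
theorem boltzmann_permute (P : Params) (β : ℝ) (π : Equiv.Perm (Fin P.d)) (U : GaugeField P 0 G) :
    boltzmann P β (U.permute π) = boltzmann P β U := by
  rw [boltzmann, boltzmann, GaugeField.wilsonAction4_permute]

/-- The Boltzmann weight is invariant under axis reflections. [folklore] -/
theorem boltzmann_reflect (P : Params) (β : ℝ) (μ : Fin P.d) (U : GaugeField P 0 G) :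
    boltzmann P β (U.reflect μ) = boltzmann P β U := by
  rw [boltzmann, boltzmann, GaugeField.wilsonAction4_reflect]

variable [MeasurableSpace G] [HaarData G]

/-- **Torus expectations are invariant under coordinate permutations**: `⟨F ∘ π⟩_{P,β} = ⟨F⟩_{P,β}` for EVERY `F` and
every real `β` (the documented junk values of `expect` are respected: both sides are junk together). [folklore] -/
theorem expect_permute (P : Params) (β : ℝ) (π : Equiv.Perm (Fin P.d)) (F : GaugeField P 0 G → ℝ) :
    expect P β (fun U => F (U.permute π)) = expect (G := G) P β F := by
  unfold expect
  congr 1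
  calc ∫ U, F (U.permute π) * boltzmann P β U ∂fieldMeasure P 0 G
      = ∫ U, (fun V => F V * boltzmann P β V) (U.permute π) ∂fieldMeasure P 0 G := by
        congr 1
        funext U
        simp only [boltzmann_permute]
    _ = ∫ V, F V * boltzmann P β V ∂fieldMeasure P 0 G :=
        GaugeField.integral_comp_permute (G := G) π (fun V => F V * boltzmann P β V)

/-- **Torus expectations are invariant under axis reflections**: `⟨F ∘ r_μ⟩_{P,β} = ⟨F⟩_{P,β}` for EVERY `F` and every
real `β` (hypothesis: inversion on `G` is measurable). [folklore] -/
theorem expect_reflect [MeasurableInv G] (P : Params) (β : ℝ) (μ : Fin P.d) (F : GaugeField P 0 G → ℝ) :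
    expect P β (fun U => F (U.reflect μ)) = expect (G := G) P β F := by
  unfold expect
  congr 1
  calc ∫ U, F (U.reflect μ) * boltzmann P β U ∂fieldMeasure P 0 G
      = ∫ U, (fun V => F V * boltzmann P β V) (U.reflect μ) ∂fieldMeasure P 0 G := by
        congr 1
        funext U
        simp only [boltzmann_reflect]
    _ = ∫ V, F V * boltzmann P β V ∂fieldMeasure P 0 G :=
        GaugeField.integral_comp_reflect (G := G) μ (fun V => F V * boltzmann P β V)

end PointGroup

/-! ## 5. Exact expectation symmetries, schemes, and what every continuum-limit point inherits -/

section Symmetry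

variable {G : Type*} [GaugeGroup G] [MeasurableSpace G] [HaarData G]

/-- An EXACT SYMMETRY of the torus expectation at parameters `P`, inverse coupling `β`: a map `Φ` of configuration space
with `⟨F ∘ Φ⟩_{P,β} = ⟨F⟩_{P,β}` for every observable `F`. [folklore] -/
def IsExpectSymmetry (P : Params) (β : ℝ) (Φ : GaugeField P 0 G → GaugeField P 0 G) : Prop :=
  ∀ F : GaugeField P 0 G → ℝ, expect P β (fun U => F (Φ U)) = expect (G := G) P β F

namespace IsExpectSymmetry

variable {P : Params} {β : ℝ}

/-- The identity is an exact symmetry. [folklore] -/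
theorem id : IsExpectSymmetry (G := G) P β _root_.id := fun _ => rfl

/-- Exact symmetries compose (so the group they generate — every lattice isometry of the torus — consists of exact
symmetries). [folklore] -/
theorem comp {Φ Ψ : GaugeField P 0 G → GaugeField P 0 G} (hΦ : IsExpectSymmetry P β Φ)
    (hΨ : IsExpectSymmetry P β Ψ) : IsExpectSymmetry P β (Φ ∘ Ψ) := fun F => by
  have h1 := hΨ (fun U => F (Φ U))
  have h2 := hΦ F
  simp only [Function.comp_apply]
  exact h1.trans h2

/-- Lattice translations are exact symmetries (`TorusLimitAxioms`). [folklore] -/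
theorem translate (a : Site P 0) : IsExpectSymmetry (G := G) P β (GaugeField.translate a) :=
  fun F => expect_translate P β a F

/-- Coordinate permutations are exact symmetries. [folklore] -/
theorem permute (π : Equiv.Perm (Fin P.d)) : IsExpectSymmetry (G := G) P β (GaugeField.permute π) :=
  fun F => expect_permute P β π F

/-- Axis reflections are exact symmetries. [folklore] -/
theorem reflect [MeasurableInv G] (μ : Fin P.d) : IsExpectSymmetry (G := G) P β (GaugeField.reflect μ) :=
  fun F => expect_reflect P β μ F

end IsExpectSymmetry

variable {O : Type*}

/-- **A relabelling `σ` of the observables that is realised, at every step `K`, by an exact symmetry `Φ_K` of the `K`-th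
lattice approximation (`obs_K(σ o) = obs_K(o) ∘ Φ_K`) leaves every joint expectation unchanged.**  For lattice loops
approximating continuum loops on the torus, the relabellings induced by the `L`-adic translations and by the point group
`B_d` (coordinate permutations and sign changes about the origin / a lattice point) are of this kind — the whole lattice
isometry group; a generic translation or a rotation outside `B_d` is NOT (it does not act on lattice loops at all). [folklore] -/
theorem TorusScheme.expectAt_map_eq_of_symmetry (S : TorusScheme G O) (σ : O → O)
    (hσ : ∀ K, ∃ Φ : GaugeField (S.P K) 0 G → GaugeField (S.P K) 0 G,
      IsExpectSymmetry (S.P K) (S.β K) Φ ∧ ∀ o, S.obs K (σ o) = fun U => S.obs K o (Φ U))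
    (K : ℕ) (os : List O) : S.expectAt K (os.map σ) = S.expectAt K os := by
  obtain ⟨Φ, hΦ, ho⟩ := hσ K
  unfold TorusScheme.expectAt
  have h : (fun U : GaugeField (S.P K) 0 G => ((os.map σ).map fun o => S.obs K o U).prod) =
      fun U => (fun V => (os.map fun o => S.obs K o V).prod) (Φ U) := by
    funext U
    simp only [List.map_map, Function.comp_def, ho]
  rw [h]
  exact hΦ (fun V => (os.map fun o => S.obs K o V).prod)

/-- **Every continuum-limit point inherits invariance under such a relabelling** (closed condition
`IsLimitFunctional.map_invariant`): the INHERITED part of Euclidean invariance = the lattice isometries; the rest is the open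
restoration (the cell contract's word; Douglas p. 2: "invariance under the isometry group of the flat metric on ℝ⁴" is part of what must be
established).  Realisation at all LARGE `K` suffices: §8 `limit_symmetry_invariant_of_eventually`. [cite: Douglas2004ClayYM, p.2] -/
theorem TorusScheme.limit_symmetry_invariant (S : TorusScheme G O) (σ : O → O)
    (hσ : ∀ K, ∃ Φ : GaugeField (S.P K) 0 G → GaugeField (S.P K) 0 G,
      IsExpectSymmetry (S.P K) (S.β K) Φ ∧ ∀ o, S.obs K (σ o) = fun U => S.obs K o (Φ U))
    {φ : ℕ → ℕ} {E : List O → ℝ} (hE : IsLimitFunctional (fun K => S.expectAt (φ K)) E) (os : List O) :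
    E (os.map σ) = E os :=
  hE.map_invariant σ (fun K os' => S.expectAt_map_eq_of_symmetry σ hσ (φ K) os') os

/-- Coordinate permutations: a relabelling realised at every step by SOME coordinate permutation of `T^{(0)}_K` changes no
joint expectation. [folklore] -/
theorem TorusScheme.expectAt_map_eq_of_permute (S : TorusScheme G O) (σ : O → O)
    (hσ : ∀ K, ∃ π : Equiv.Perm (Fin (S.P K).d), ∀ o, S.obs K (σ o) = fun U => S.obs K o (U.permute π))
    (K : ℕ) (os : List O) : S.expectAt K (os.map σ) = S.expectAt K os :=
  S.expectAt_map_eq_of_symmetry σ (fun K => by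
    obtain ⟨π, hπ⟩ := hσ K
    exact ⟨_, IsExpectSymmetry.permute π, hπ⟩) K os

/-- Axis reflections: a relabelling realised at every step by SOME axis reflection of `T^{(0)}_K` changes no joint
expectation. [folklore] -/
theorem TorusScheme.expectAt_map_eq_of_reflect [MeasurableInv G] (S : TorusScheme G O) (σ : O → O)
    (hσ : ∀ K, ∃ μ : Fin (S.P K).d, ∀ o, S.obs K (σ o) = fun U => S.obs K o (U.reflect μ))
    (K : ℕ) (os : List O) : S.expectAt K (os.map σ) = S.expectAt K os :=
  S.expectAt_map_eq_of_symmetry σ (fun K => by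
    obtain ⟨μ, hμ⟩ := hσ K
    exact ⟨_, IsExpectSymmetry.reflect μ, hμ⟩) K os

/-- **Every limit point is invariant under relabellings realised by coordinate permutations.** [cite: Douglas2004ClayYM, p.2] -/
theorem TorusScheme.limit_permute_invariant (S : TorusScheme G O) (σ : O → O)
    (hσ : ∀ K, ∃ π : Equiv.Perm (Fin (S.P K).d), ∀ o, S.obs K (σ o) = fun U => S.obs K o (U.permute π))
    {φ : ℕ → ℕ} {E : List O → ℝ} (hE : IsLimitFunctional (fun K => S.expectAt (φ K)) E) (os : List O) :
    E (os.map σ) = E os :=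
  hE.map_invariant σ (fun K os' => S.expectAt_map_eq_of_permute σ hσ (φ K) os') os

/-- **Every limit point is invariant under relabellings realised by axis reflections.** [cite: Douglas2004ClayYM, p.2] -/
theorem TorusScheme.limit_reflect_invariant [MeasurableInv G] (S : TorusScheme G O) (σ : O → O)
    (hσ : ∀ K, ∃ μ : Fin (S.P K).d, ∀ o, S.obs K (σ o) = fun U => S.obs K o (U.reflect μ))
    {φ : ℕ → ℕ} {E : List O → ℝ} (hE : IsLimitFunctional (fun K => S.expectAt (φ K)) E) (os : List O) :
    E (os.map σ) = E os :=
  hE.map_invariant σ (fun K os' => S.expectAt_map_eq_of_reflect σ hσ (φ K) os') os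

/-! ### Wilson-loop schemes: the relabelling is the image loop -/

/-- For a scheme of Wilson loops (`obs_K(o) = W_{loop K o}`), a relabelling whose loops are, at every step, the images of
the original loops under one coordinate permutation changes no joint expectation. [folklore] -/
theorem TorusScheme.expectAt_map_eq_of_loop_permute (S : TorusScheme G O)
    (loop : (K : ℕ) → O → List (PathStep (S.P K))) (hS : ∀ K o, S.obs K o = fun U => wilsonLoop U (loop K o))
    (σ : O → O) (hσ : ∀ K, ∃ π : Equiv.Perm (Fin (S.P K).d), ∀ o, loop K (σ o) = (loop K o).map (PathStep.permute π))
    (K : ℕ) (os : List O) : S.expectAt K (os.map σ) = S.expectAt K os :=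
  S.expectAt_map_eq_of_permute σ (fun K => by
    obtain ⟨π, hπ⟩ := hσ K
    refine ⟨π, fun o => ?_⟩
    funext U
    simp only [hS, hπ, wilsonLoop_permute]) K os

/-- Same for axis reflections of the loops. [folklore] -/
theorem TorusScheme.expectAt_map_eq_of_loop_reflect [MeasurableInv G] (S : TorusScheme G O)
    (loop : (K : ℕ) → O → List (PathStep (S.P K))) (hS : ∀ K o, S.obs K o = fun U => wilsonLoop U (loop K o))
    (σ : O → O) (hσ : ∀ K, ∃ μ : Fin (S.P K).d, ∀ o, loop K (σ o) = (loop K o).map (PathStep.reflect μ))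
    (K : ℕ) (os : List O) : S.expectAt K (os.map σ) = S.expectAt K os :=
  S.expectAt_map_eq_of_reflect σ (fun K => by
    obtain ⟨μ, hμ⟩ := hσ K
    refine ⟨μ, fun o => ?_⟩
    funext U
    simp only [hS, hμ, wilsonLoop_reflect]) K os

/-! ### Non-vacuity of the compatibility hypothesis: adjoin the images under an involutive symmetry -/

omit [GaugeGroup G] [MeasurableSpace G] [HaarData G] in
/-- Any scheme extends by the images of its observables under chosen maps `Φ_K` of the configuration spaces: labels
`O ⊕ O`, `inl o ↦ obs(o)`, `inr o ↦ obs(o) ∘ Φ_K`. [folklore] -/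
def TorusScheme.withImage (S : TorusScheme G O) (Φ : (K : ℕ) → GaugeField (S.P K) 0 G → GaugeField (S.P K) 0 G) :
    TorusScheme G (O ⊕ O) where
  P := S.P
  sites_tendsto := S.sites_tendsto
  β := S.β
  obs K := fun
    | Sum.inl o => S.obs K o
    | Sum.inr o => fun U => S.obs K o (Φ K U)

omit [GaugeGroup G] [MeasurableSpace G] [HaarData G] in
/-- When every `Φ_K` is an involution (an axis reflection, a transposition of two coordinates, …), the swap of labels in
`S.withImage Φ` IS realised by `Φ_K` at every step. [folklore] -/
theorem TorusScheme.withImage_swap (S : TorusScheme G O)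
    (Φ : (K : ℕ) → GaugeField (S.P K) 0 G → GaugeField (S.P K) 0 G) (hΦ : ∀ K U, Φ K (Φ K U) = U) (K : ℕ)
    (l : O ⊕ O) : (S.withImage Φ).obs K (Sum.swap l) = fun U => (S.withImage Φ).obs K l (Φ K U) := by
  cases l with
  | inl o => rfl
  | inr o =>
    funext U
    simp only [TorusScheme.withImage, Sum.swap_inr, hΦ]

/-- Instance: every continuum-limit point of the scheme `S.withImage (r_{μ_K})` — a scheme together with the axis
reflections of its observables — is invariant under swapping each observable with its reflection. [cite: Douglas2004ClayYM, p.2] -/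
theorem TorusScheme.limit_withImage_reflect_swap_invariant [MeasurableInv G] (S : TorusScheme G O)
    (μ : (K : ℕ) → Fin (S.P K).d) {φ : ℕ → ℕ} {E : List (O ⊕ O) → ℝ}
    (hE : IsLimitFunctional (fun K => (S.withImage fun K => GaugeField.reflect (μ K)).expectAt (φ K)) E)
    (os : List (O ⊕ O)) : E (os.map Sum.swap) = E os :=
  (S.withImage fun K => GaugeField.reflect (μ K)).limit_reflect_invariant Sum.swap
    (fun K => ⟨μ K, S.withImage_swap _ (fun K U => GaugeField.reflect_reflect (μ K) U) K⟩) hE os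

end Symmetry

end Missing

/-! ## 6. Consistency with `TorusReflectionPositivity`: the Osterwalder–Seiler site reflection IS the axis reflection `r_0` -/

section Consistency

variable {P : Params} {G : Type*}

/-- The Osterwalder–Seiler bond reflection `θ'` of `TorusReflectionPositivity` (the host tree's `WilsonSiteRP.siteEdgeReflect`
read through the dictionary) is the bond reflection `r_0` of this file. [folklore] -/
theorem PBond.siteReflect_eq_reflect_zero (b : PBond P 0) : b.siteReflect = b.reflect 0 := by
  obtain ⟨x, ν⟩ := b
  by_cases h : ν = 0
  · subst h
    simp [PBond.siteReflect, WilsonSiteRP.siteEdgeReflect, PBond.reflect, shift_eq_shift, Site.reflect,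
      QuantumFieldTheory.Site.negReflect]
  · simp [PBond.siteReflect, WilsonSiteRP.siteEdgeReflect, PBond.reflect, h, Site.reflect,
      QuantumFieldTheory.Site.negReflect]

/-- … and the reflected path step `θ's` of `TorusReflectionPositivity` is `r_0 s`. [folklore] -/
theorem Missing.PathStep.siteReflect_eq_reflect_zero (s : Missing.PathStep P) : s.siteReflect = s.reflect 0 := by
  rw [Missing.PathStep.siteReflect, Missing.PathStep.reflect, PBond.siteReflect_eq_reflect_zero]

variable [GaugeGroup G]

/-- The time reflection `Θ'` of `TorusReflectionPositivity` (transported from the host tree's `GaugeConfig.negReflect`) is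
the axis reflection `r_0` of this file on Bałaban's level-0 torus: reflection positivity (there) and exact invariance (here)
concern the same point-group element. [folklore] -/
theorem GaugeField.negReflect_eq_reflect_zero (U : GaugeField P 0 G) : U.negReflect = U.reflect 0 := by
  funext b
  rw [GaugeField.negReflect_apply, GaugeField.reflect_apply, PBond.siteReflect_eq_reflect_zero]

/-- Hence `Θ'` is an exact symmetry of the torus expectations: `⟨F ∘ Θ'⟩ = ⟨F⟩` (every real `β`, every `F`). [folklore] -/
theorem Missing.expect_negReflect [MeasurableSpace G] [HaarData G] [MeasurableInv G] (P : Params) (β : ℝ)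
    (F : GaugeField P 0 G → ℝ) : Missing.expect P β (fun U => F U.negReflect) = Missing.expect (G := G) P β F := by
  have h : (fun U : GaugeField P 0 G => F U.negReflect) = fun U => F (U.reflect 0) := by
    funext U
    rw [GaugeField.negReflect_eq_reflect_zero]
  rw [h]
  exact Missing.expect_reflect P β 0 F

end Consistency

/-! ## 7. (v1.1) Wilson loops forget base point and orientation; Chatterjee's lattice rectangles under the point group

[folklore] bookkeeping for the §C1 objects of `MISSING.md` — the rectangular loops `Missing.rectLoop x μ ν a b` of `WilsonLoopLimit`
(`∂([x, x + a e_μ] × [x, x + b e_ν])`, [ChatterjeeYMProb2019] §5 Problem 5.2).  `Re tr` of a holonomy is invariant under cyclic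
permutation and inversion (`GaugeGroup.reTr_conj`, `reTr_inv`), so the Wilson loop variable of a closed lattice path sees neither
where the path starts (`wilsonLoop_append_comm`, `wilsonLoop_rotate`) nor its orientation (`wilsonLoop_pathReverse`); the backward
segment is the reversed forward segment and the oppositely oriented rectangle is the reversed rectangle (`rectLoop_swap`).  The
point group maps the family of ALL lattice rectangles to itself: `rectLoop_map_permute` (coordinate permutations, on the nose) and
`wilsonLoop_reflect_rectLoop` (an axis reflection carries the Wilson loop of a rectangle to the Wilson loop of the reflected
rectangle, re-based at `reflCorner` and re-oriented).  Consequently, for a `RectLoopScheme` whose labels are closed under a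
point-group element acting on (corner, directions, sides), NO joint expectation changes under the induced relabelling and EVERY
continuum-limit point is invariant under it (`RectLoopScheme.limit_permute_invariant`, `RectLoopScheme.limit_reflect_invariant`);
non-vacuity: `RectLoopScheme.permutes`, `RectLoopScheme.withReflected`.  This is the inherited (lattice) part of Euclidean
invariance for the rung-+1 objects; rotations outside the point group and generic translations remain the open restoration (C2a). -/

namespace Site

variable {P : Params} {j : ℕ}

/-- Permuting coordinates carries `n` steps in direction `μ` to `n` steps in direction `π μ`. [folklore] -/
theorem move_permute (π : Equiv.Perm (Fin P.d)) (x : Site P j) (μ : Fin P.d) (n : ℕ) :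
    (x.move μ n).permute π = (x.permute π).move (π μ) n := by
  funext ν
  by_cases h : ν = π μ
  · subst h
    simp [Site.move, permute]
  · have h' : π.symm ν ≠ μ := fun h'' => h (by rw [← h'', Equiv.apply_symm_apply])
    simp [Site.move, permute, Function.update_of_ne h, Function.update_of_ne h']

/-- Reflection of the `μ`-th axis commutes with moves in the other directions. [folklore] -/
theorem move_reflect_of_ne (μ : Fin P.d) (x : Site P j) {ν : Fin P.d} (h : ν ≠ μ) (n : ℕ) :
    (x.move ν n).reflect μ = (x.reflect μ).move ν n := by
  funext κ
  by_cases hκμ : κ = μ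
  · subst hκμ
    simp only [reflect, Site.move, Function.update_self, Function.update_of_ne (Ne.symm h)]
  · by_cases hκν : κ = ν
    · subst hκν
      simp only [reflect, Site.move, Function.update_self, Function.update_of_ne hκμ]
    · simp only [reflect, Site.move, Function.update_of_ne hκμ, Function.update_of_ne hκν]

/-- `r_μ (x + n e_μ) + n e_μ = r_μ x`. [folklore] -/
theorem reflect_move_move (μ : Fin P.d) (x : Site P j) (n : ℕ) : ((x.move μ n).reflect μ).move μ n = x.reflect μ := by
  funext κ
  by_cases h : κ = μ
  · subst h
    simp only [reflect, Site.move, Function.update_self]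
    ring
  · simp only [reflect, Site.move, Function.update_of_ne h]

/-- A unit step commutes with moves: `(x + e_μ) + n e_ν = (x + n e_ν) + e_μ`. [folklore] -/
theorem shift_move_comm (x : Site P j) (μ ν : Fin P.d) (n : ℕ) : (x.shift μ).move ν n = (x.move ν n).shift μ := by
  rw [← Site.move_one, Site.move_comm, Site.move_one]

/-- `(x + e_μ) + n e_μ = x + (n+1) e_μ`. [folklore] -/
theorem shift_move (x : Site P j) (μ : Fin P.d) (n : ℕ) : (x.shift μ).move μ n = x.move μ (n + 1) := by
  rw [shift_move_comm, Site.move_succ]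

end Site

namespace Missing

section LoopGeometry

variable {P : Params}

/-- The reversed step (same bond, opposite orientation). [folklore] -/
def PathStep.rev (s : PathStep P) : PathStep P := ⟨s.bond, !s.fwd⟩

/-- Reversing a step twice gives it back. [folklore] -/
@[simp] theorem PathStep.rev_rev (s : PathStep P) : s.rev.rev = s := by
  obtain ⟨b, f⟩ := s
  simp [PathStep.rev]

/-- The reversed path `γ⁻¹`: the steps in reverse order, each with reversed orientation. [folklore] -/
def pathReverse (γ : List (PathStep P)) : List (PathStep P) := (γ.map PathStep.rev).reverse

/-- `(γ₁ γ₂)⁻¹ = γ₂⁻¹ γ₁⁻¹`. [folklore] -/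
theorem pathReverse_append (γ₁ γ₂ : List (PathStep P)) :
    pathReverse (γ₁ ++ γ₂) = pathReverse γ₂ ++ pathReverse γ₁ := by
  simp [pathReverse, List.map_append, List.reverse_append]

/-- `(s γ)⁻¹ = γ⁻¹ s⁻¹`. [folklore] -/
theorem pathReverse_cons (s : PathStep P) (γ : List (PathStep P)) : pathReverse (s :: γ) = pathReverse γ ++ [s.rev] := by
  simp [pathReverse]

/-- `(γ⁻¹)⁻¹ = γ`. [folklore] -/
@[simp] theorem pathReverse_pathReverse (γ : List (PathStep P)) : pathReverse (pathReverse γ) = γ := by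
  simp [pathReverse, List.map_reverse, List.map_map, Function.comp_def]

/-- Coordinate permutation commutes with path reversal. [folklore] -/
theorem pathReverse_map_permute (π : Equiv.Perm (Fin P.d)) (γ : List (PathStep P)) :
    pathReverse (γ.map (PathStep.permute π)) = (pathReverse γ).map (PathStep.permute π) := by
  simp only [pathReverse, List.map_reverse, List.map_map, Function.comp_def]
  rfl

/-- Axis reflection commutes with step reversal. [folklore] -/
theorem PathStep.reflect_rev (μ : Fin P.d) (s : PathStep P) : s.rev.reflect μ = (s.reflect μ).rev := by
  obtain ⟨b, f⟩ := s
  by_cases h : b.dir = μ <;> simp [PathStep.rev, PathStep.reflect, h]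

/-- Axis reflection commutes with path reversal. [folklore] -/
theorem pathReverse_map_reflect (μ : Fin P.d) (γ : List (PathStep P)) :
    pathReverse (γ.map (PathStep.reflect μ)) = (pathReverse γ).map (PathStep.reflect μ) := by
  simp only [pathReverse, List.map_reverse, List.map_map, Function.comp_def, PathStep.reflect_rev]

variable {G : Type*} [GaugeGroup G]

/-- Holonomy is multiplicative under concatenation. [folklore] -/
theorem pathHol_append (U : GaugeField P 0 G) (γ₁ γ₂ : List (PathStep P)) :
    pathHol U (γ₁ ++ γ₂) = pathHol U γ₁ * pathHol U γ₂ := by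
  simp [pathHol, List.map_append, List.prod_append]

/-- The step variable of the reversed step is the inverse step variable. [folklore] -/
theorem stepHol_rev (U : GaugeField P 0 G) (s : PathStep P) :
    (if s.rev.fwd then U s.rev.bond else (U s.rev.bond)⁻¹) = (if s.fwd then U s.bond else (U s.bond)⁻¹)⁻¹ := by
  obtain ⟨b, f⟩ := s
  cases f <;> simp [PathStep.rev]

/-- **Holonomy of the reversed path is the inverse holonomy.** [folklore] -/
theorem pathHol_pathReverse (U : GaugeField P 0 G) (γ : List (PathStep P)) :
    pathHol U (pathReverse γ) = (pathHol U γ)⁻¹ := by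
  simp only [pathHol, pathReverse, List.map_reverse, List.map_map, List.prod_inv_reverse]
  congr 2
  exact List.map_congr_left fun s _ => stepHol_rev U s

/-- **Wilson loops do not see the orientation**: `W_{γ⁻¹} = W_γ` (`Re tr g⁻¹ = Re tr g`). [folklore] -/
theorem wilsonLoop_pathReverse (U : GaugeField P 0 G) (γ : List (PathStep P)) :
    wilsonLoop U (pathReverse γ) = wilsonLoop U γ := by
  rw [wilsonLoop, wilsonLoop, pathHol_pathReverse, GaugeGroup.reTr_inv]

omit [GaugeGroup G] in
/-- `Re tr (g h) = Re tr (h g)` (the normalised trace is a class function). [folklore] -/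
theorem reTr_mul_comm [GaugeGroup G] (g h : G) : reTr (g * h) = reTr (h * g) := by
  have h1 := GaugeGroup.reTr_conj (h * g) g
  rwa [show g * (h * g) * g⁻¹ = g * h by group] at h1

/-- **Wilson loops do not see the base point**: `W_{γ₁ γ₂} = W_{γ₂ γ₁}`. [folklore] -/
theorem wilsonLoop_append_comm (U : GaugeField P 0 G) (γ₁ γ₂ : List (PathStep P)) :
    wilsonLoop U (γ₁ ++ γ₂) = wilsonLoop U (γ₂ ++ γ₁) := by
  rw [wilsonLoop, wilsonLoop, pathHol_append, pathHol_append, reTr_mul_comm]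

/-- … equivalently, `W` is invariant under cyclic rotation of the closed path. [folklore] -/
theorem wilsonLoop_rotate (U : GaugeField P 0 G) (γ : List (PathStep P)) (n : ℕ) :
    wilsonLoop U (γ.rotate n) = wilsonLoop U γ := by
  rw [List.rotate_eq_drop_append_take_mod, wilsonLoop_append_comm, List.take_append_drop]

/-! ### Segments and rectangles -/

omit [GaugeGroup G] in
/-- The forward segment peeled from its initial point: `[x, x+(n+1)e_μ] = (x → x+e_μ) · [x+e_μ, x+(n+1)e_μ]`. [folklore] -/
theorem fwdSeg_succ' (x : Site P 0) (μ : Fin P.d) : ∀ n : ℕ,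
    fwdSeg x μ (n + 1) = ⟨⟨x, μ⟩, true⟩ :: fwdSeg (x.shift μ) μ n
  | 0 => by simp [fwdSeg]
  | n + 1 => by
    have h1 : fwdSeg x μ (n + 1 + 1) = fwdSeg x μ (n + 1) ++ [⟨⟨x.move μ (n + 1), μ⟩, true⟩] := rfl
    have h2 : fwdSeg (x.shift μ) μ (n + 1) = fwdSeg (x.shift μ) μ n ++ [⟨⟨(x.shift μ).move μ n, μ⟩, true⟩] := rfl
    rw [h1, h2, fwdSeg_succ' x μ n, List.cons_append, Site.shift_move]

omit [GaugeGroup G] in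
/-- **The backward segment is the reversed forward segment.** [folklore] -/
theorem bwdSeg_eq_pathReverse_fwdSeg (x : Site P 0) (μ : Fin P.d) : ∀ n : ℕ, bwdSeg x μ n = pathReverse (fwdSeg x μ n)
  | 0 => rfl
  | n + 1 => by
    simp only [bwdSeg, fwdSeg, pathReverse_append, bwdSeg_eq_pathReverse_fwdSeg x μ n]
    rfl

omit [GaugeGroup G] in
/-- `[x, x+n e_μ]⁻¹` reversed is the backward segment. [folklore] -/
theorem pathReverse_fwdSeg (x : Site P 0) (μ : Fin P.d) (n : ℕ) : pathReverse (fwdSeg x μ n) = bwdSeg x μ n :=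
  (bwdSeg_eq_pathReverse_fwdSeg x μ n).symm

omit [GaugeGroup G] in
/-- The backward segment reversed is the forward segment. [folklore] -/
theorem pathReverse_bwdSeg (x : Site P 0) (μ : Fin P.d) (n : ℕ) : pathReverse (bwdSeg x μ n) = fwdSeg x μ n := by
  rw [bwdSeg_eq_pathReverse_fwdSeg, pathReverse_pathReverse]

omit [GaugeGroup G] in
/-- **The oppositely oriented rectangle** (directions and sides swapped, same corner) **is the reversed rectangle.** [folklore] -/
theorem rectLoop_swap (x : Site P 0) (μ ν : Fin P.d) (a b : ℕ) :
    rectLoop x ν μ b a = pathReverse (rectLoop x μ ν a b) := by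
  simp only [rectLoop, pathReverse_append, pathReverse_fwdSeg, pathReverse_bwdSeg, List.append_assoc]

/-- Hence the Wilson loop of a lattice rectangle does not depend on its orientation. [folklore] -/
theorem wilsonLoop_rectLoop_swap (U : GaugeField P 0 G) (x : Site P 0) (μ ν : Fin P.d) (a b : ℕ) :
    wilsonLoop U (rectLoop x ν μ b a) = wilsonLoop U (rectLoop x μ ν a b) := by
  rw [rectLoop_swap, wilsonLoop_pathReverse]

/-! ### Rectangles under coordinate permutations -/

omit [GaugeGroup G] in
/-- Forward segments under a coordinate permutation. [folklore] -/
theorem fwdSeg_map_permute (π : Equiv.Perm (Fin P.d)) (x : Site P 0) (μ : Fin P.d) : ∀ n : ℕ,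
    (fwdSeg x μ n).map (PathStep.permute π) = fwdSeg (x.permute π) (π μ) n
  | 0 => rfl
  | n + 1 => by
    simp only [fwdSeg, List.map_append, List.map_cons, List.map_nil, fwdSeg_map_permute π x μ n, PathStep.permute,
      PBond.permute, Site.move_permute]

omit [GaugeGroup G] in
/-- Backward segments under a coordinate permutation. [folklore] -/
theorem bwdSeg_map_permute (π : Equiv.Perm (Fin P.d)) (x : Site P 0) (μ : Fin P.d) : ∀ n : ℕ,
    (bwdSeg x μ n).map (PathStep.permute π) = bwdSeg (x.permute π) (π μ) n
  | 0 => rfl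
  | n + 1 => by
    simp only [bwdSeg, List.map_cons, bwdSeg_map_permute π x μ n, PathStep.permute, PBond.permute, Site.move_permute]

omit [GaugeGroup G] in
/-- **Coordinate permutations map lattice rectangles to lattice rectangles**: `π·∂([x,x+aμ]×[x,x+bν]) = ∂([πx, πx+a e_{πμ}]×[πx, πx+b e_{πν}])`. [folklore] -/
theorem rectLoop_map_permute (π : Equiv.Perm (Fin P.d)) (x : Site P 0) (μ ν : Fin P.d) (a b : ℕ) :
    (rectLoop x μ ν a b).map (PathStep.permute π) = rectLoop (x.permute π) (π μ) (π ν) a b := by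
  simp only [rectLoop, List.map_append, fwdSeg_map_permute, bwdSeg_map_permute, Site.move_permute]

/-- `W_{∂R}(π·U) = W_{∂(πR)}(U)` for lattice rectangles. [folklore] -/
theorem wilsonLoop_permute_rectLoop (π : Equiv.Perm (Fin P.d)) (U : GaugeField P 0 G) (x : Site P 0) (μ ν : Fin P.d)
    (a b : ℕ) : wilsonLoop (U.permute π) (rectLoop x μ ν a b) = wilsonLoop U (rectLoop (x.permute π) (π μ) (π ν) a b) := by
  rw [wilsonLoop_permute, rectLoop_map_permute]

/-! ### Rectangles under axis reflections -/

omit [GaugeGroup G] in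
/-- Forward segments in a direction `ν ≠ μ` under `r_μ`. [folklore] -/
theorem fwdSeg_map_reflect_of_ne (μ : Fin P.d) (x : Site P 0) {ν : Fin P.d} (h : ν ≠ μ) : ∀ n : ℕ,
    (fwdSeg x ν n).map (PathStep.reflect μ) = fwdSeg (x.reflect μ) ν n
  | 0 => rfl
  | n + 1 => by
    simp only [fwdSeg, List.map_append, List.map_cons, List.map_nil, fwdSeg_map_reflect_of_ne μ x h n,
      PathStep.reflect, PBond.reflect, if_neg h, Site.move_reflect_of_ne μ x h]

omit [GaugeGroup G] in
/-- Backward segments in a direction `ν ≠ μ` under `r_μ`. [folklore] -/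
theorem bwdSeg_map_reflect_of_ne (μ : Fin P.d) (x : Site P 0) {ν : Fin P.d} (h : ν ≠ μ) : ∀ n : ℕ,
    (bwdSeg x ν n).map (PathStep.reflect μ) = bwdSeg (x.reflect μ) ν n
  | 0 => rfl
  | n + 1 => by
    simp only [bwdSeg, List.map_cons, bwdSeg_map_reflect_of_ne μ x h n, PathStep.reflect, PBond.reflect, if_neg h,
      Site.move_reflect_of_ne μ x h]

omit [GaugeGroup G] in
/-- **A forward `μ`-segment under `r_μ` is a BACKWARD segment**: `r_μ [x, x+nμ] = [r_μ x − nμ, r_μ x]` traversed downwards. [folklore] -/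
theorem fwdSeg_map_reflect_self (μ : Fin P.d) : ∀ (x : Site P 0) (n : ℕ),
    (fwdSeg x μ n).map (PathStep.reflect μ) = bwdSeg ((x.move μ n).reflect μ) μ n
  | _, 0 => rfl
  | x, n + 1 => by
    rw [fwdSeg_succ', List.map_cons, fwdSeg_map_reflect_self μ (x.shift μ) n, ← Site.shift_move, bwdSeg,
      Site.reflect_move_move]
    simp [PathStep.reflect, PBond.reflect]

omit [GaugeGroup G] in
/-- A backward `μ`-segment under `r_μ` is a forward segment. [folklore] -/
theorem bwdSeg_map_reflect_self (μ : Fin P.d) (x : Site P 0) (n : ℕ) :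
    (bwdSeg x μ n).map (PathStep.reflect μ) = fwdSeg ((x.move μ n).reflect μ) μ n := by
  rw [bwdSeg_eq_pathReverse_fwdSeg, ← pathReverse_map_reflect, fwdSeg_map_reflect_self, pathReverse_bwdSeg]

omit [GaugeGroup G] in
/-- `r_ρ` on a rectangle in a coordinate plane not containing `ρ`: the reflected rectangle, same orientation. [folklore] -/
theorem rectLoop_map_reflect_of_ne (ρ : Fin P.d) (x : Site P 0) {μ ν : Fin P.d} (hμ : μ ≠ ρ) (hν : ν ≠ ρ) (a b : ℕ) :
    (rectLoop x μ ν a b).map (PathStep.reflect ρ) = rectLoop (x.reflect ρ) μ ν a b := by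
  simp only [rectLoop, List.map_append, fwdSeg_map_reflect_of_ne ρ _ hμ, fwdSeg_map_reflect_of_ne ρ _ hν,
    bwdSeg_map_reflect_of_ne ρ _ hμ, bwdSeg_map_reflect_of_ne ρ _ hν, Site.move_reflect_of_ne ρ _ hμ,
    Site.move_reflect_of_ne ρ _ hν]

omit [GaugeGroup G] in
/-- `r_μ` on a rectangle whose FIRST direction is `μ`: the image path, segment by segment (it is the oppositely oriented reflected
rectangle started at another corner). [folklore] -/
theorem rectLoop_map_reflect_fst (x : Site P 0) {μ ν : Fin P.d} (hμν : μ ≠ ν) (a b : ℕ) :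
    (rectLoop x μ ν a b).map (PathStep.reflect μ) =
      bwdSeg ((x.move μ a).reflect μ) μ a ++ (fwdSeg ((x.move μ a).reflect μ) ν b ++
        (fwdSeg (((x.move μ a).reflect μ).move ν b) μ a ++ bwdSeg (x.reflect μ) ν b)) := by
  simp only [rectLoop, List.map_append, fwdSeg_map_reflect_self, fwdSeg_map_reflect_of_ne μ _ hμν.symm,
    bwdSeg_map_reflect_self, bwdSeg_map_reflect_of_ne μ _ hμν.symm, Site.move_comm x ν μ b a,
    Site.move_reflect_of_ne μ _ hμν.symm]

omit [GaugeGroup G] in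
/-- `r_ν` on a rectangle whose SECOND direction is `ν`: the image path, segment by segment. [folklore] -/
theorem rectLoop_map_reflect_snd (x : Site P 0) {μ ν : Fin P.d} (hμν : μ ≠ ν) (a b : ℕ) :
    (rectLoop x μ ν a b).map (PathStep.reflect ν) =
      fwdSeg (x.reflect ν) μ a ++ (bwdSeg (((x.move ν b).reflect ν).move μ a) ν b ++
        (bwdSeg ((x.move ν b).reflect ν) μ a ++ fwdSeg ((x.move ν b).reflect ν) ν b)) := by
  simp only [rectLoop, List.map_append, fwdSeg_map_reflect_of_ne ν _ hμν, fwdSeg_map_reflect_self,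
    bwdSeg_map_reflect_of_ne ν _ hμν, bwdSeg_map_reflect_self, Site.move_comm x μ ν a b,
    Site.move_reflect_of_ne ν _ hμν]

/-- `W_{∂R}(r_μ U)` for a rectangle with first direction `μ` = the Wilson loop of the reflected rectangle `r_μ R`, written with the
same direction labels and corner `r_μ(x + aμ) = r_μ x − aμ`. [folklore] -/
theorem wilsonLoop_reflect_rectLoop_fst (U : GaugeField P 0 G) (x : Site P 0) {μ ν : Fin P.d} (hμν : μ ≠ ν) (a b : ℕ) :
    wilsonLoop (U.reflect μ) (rectLoop x μ ν a b) = wilsonLoop U (rectLoop ((x.move μ a).reflect μ) μ ν a b) := by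
  rw [wilsonLoop_reflect, rectLoop_map_reflect_fst x hμν, wilsonLoop_append_comm, List.append_assoc, List.append_assoc,
    ← wilsonLoop_rectLoop_swap, rectLoop, Site.reflect_move_move]

/-- `W_{∂R}(r_ν U)` for a rectangle with second direction `ν` = the Wilson loop of the reflected rectangle, corner `r_ν(x + bν)`. [folklore] -/
theorem wilsonLoop_reflect_rectLoop_snd (U : GaugeField P 0 G) (x : Site P 0) {μ ν : Fin P.d} (hμν : μ ≠ ν) (a b : ℕ) :
    wilsonLoop (U.reflect ν) (rectLoop x μ ν a b) = wilsonLoop U (rectLoop ((x.move ν b).reflect ν) μ ν a b) := by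
  rw [wilsonLoop_reflect, rectLoop_map_reflect_snd x hμν, ← List.append_assoc, ← List.append_assoc,
    wilsonLoop_append_comm, List.append_assoc, ← wilsonLoop_rectLoop_swap, rectLoop, Site.reflect_move_move]

omit [GaugeGroup G] in
/-- The corner of the reflected rectangle `r_ρ(∂([x,x+aμ]×[x,x+bν]))` when it is re-written as `rectLoop · μ ν a b`. [folklore] -/
def reflCorner (ρ : Fin P.d) (x : Site P 0) (μ ν : Fin P.d) (a b : ℕ) : Site P 0 :=
  if μ = ρ then (x.move μ a).reflect ρ else if ν = ρ then (x.move ν b).reflect ρ else x.reflect ρ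

omit [GaugeGroup G] in
/-- Reflecting twice returns the original corner. [folklore] -/
theorem reflCorner_reflCorner (ρ : Fin P.d) (x : Site P 0) (μ ν : Fin P.d) (a b : ℕ) :
    reflCorner ρ (reflCorner ρ x μ ν a b) μ ν a b = x := by
  unfold reflCorner
  by_cases hμ : μ = ρ
  · subst hμ
    simp [Site.reflect_move_move]
  · by_cases hν : ν = ρ
    · subst hν
      simp [hμ, Site.reflect_move_move]
    · simp [hμ, hν]

/-- **Axis reflections map Wilson loops of lattice rectangles to Wilson loops of lattice rectangles**:
`W_{∂R}(r_ρ U) = W_{∂R'}(U)`, `R'` the reflected rectangle with corner `reflCorner ρ …` and the same directions and sides. [folklore] -/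
theorem wilsonLoop_reflect_rectLoop (ρ : Fin P.d) (U : GaugeField P 0 G) (x : Site P 0) {μ ν : Fin P.d} (hμν : μ ≠ ν)
    (a b : ℕ) : wilsonLoop (U.reflect ρ) (rectLoop x μ ν a b) = wilsonLoop U (rectLoop (reflCorner ρ x μ ν a b) μ ν a b) := by
  unfold reflCorner
  by_cases hμ : μ = ρ
  · subst hμ
    rw [if_pos rfl]
    exact wilsonLoop_reflect_rectLoop_fst U x hμν a b
  · rw [if_neg hμ]
    by_cases hν : ν = ρ
    · subst hν
      rw [if_pos rfl]
      exact wilsonLoop_reflect_rectLoop_snd U x hμν a b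
    · rw [if_neg hν, wilsonLoop_reflect, rectLoop_map_reflect_of_ne ρ x hμ hν]

end LoopGeometry

/-! ### Rectangle schemes closed under a point-group element: no joint expectation changes, every limit point is invariant -/

namespace RectLoopScheme

variable {O : Type*} (G : Type*) [GaugeGroup G] [MeasurableSpace G] [HaarData G]

/-- **Coordinate permutations.**  If a relabelling `σ` of a rectangle scheme acts on the data as a fixed coordinate permutation
`π ∈ S₄` (corner `↦ π·corner`, directions `↦ π μ, π ν`, same sides) then no joint expectation of the scheme changes under `σ`. [folklore] -/
theorem expectAt_map_eq_of_permute (S : RectLoopScheme O) (σ : O → O) (π : Equiv.Perm (Fin 4))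
    (hc : ∀ K o, S.corner K (σ o) = (S.corner K o).permute π) (h₁ : ∀ o, S.dir₁ (σ o) = π (S.dir₁ o))
    (h₂ : ∀ o, S.dir₂ (σ o) = π (S.dir₂ o)) (hA : ∀ K o, S.sideA K (σ o) = S.sideA K o)
    (hB : ∀ K o, S.sideB K (σ o) = S.sideB K o) (K : ℕ) (os : List O) :
    (S.toTorusScheme G).expectAt K (os.map σ) = (S.toTorusScheme G).expectAt K os :=
  (S.toTorusScheme G).expectAt_map_eq_of_loop_permute S.loop (fun _ _ => rfl) σ
    (fun K => ⟨π, fun o => by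
      rw [loop, loop, hc, h₁, h₂, hA, hB]
      exact (rectLoop_map_permute (P := params4 S.L S.hL S.m K) π _ _ _ _ _).symm⟩) K os

/-- … hence **every continuum-limit point of such a scheme is invariant under `σ`** (inherited `S₄`-symmetry). [cite: Douglas2004ClayYM, p.2] -/
theorem limit_permute_invariant (S : RectLoopScheme O) (σ : O → O) (π : Equiv.Perm (Fin 4))
    (hc : ∀ K o, S.corner K (σ o) = (S.corner K o).permute π) (h₁ : ∀ o, S.dir₁ (σ o) = π (S.dir₁ o))
    (h₂ : ∀ o, S.dir₂ (σ o) = π (S.dir₂ o)) (hA : ∀ K o, S.sideA K (σ o) = S.sideA K o)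
    (hB : ∀ K o, S.sideB K (σ o) = S.sideB K o) {φ : ℕ → ℕ} {E : List O → ℝ}
    (hE : IsLimitFunctional (fun K => (S.toTorusScheme G).expectAt (φ K)) E) (os : List O) : E (os.map σ) = E os :=
  hE.map_invariant σ (fun K os' => expectAt_map_eq_of_permute G S σ π hc h₁ h₂ hA hB (φ K) os') os

/-- **Axis reflections.**  If `σ` acts on the data of a scheme of non-degenerate rectangles as a fixed axis reflection `r_ρ`
(corner `↦ reflCorner ρ …`, same directions and sides) then no joint expectation changes under `σ`. [folklore] -/
theorem expectAt_map_eq_of_reflect [MeasurableInv G] (S : RectLoopScheme O) (σ : O → O) (ρ : Fin 4)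
    (hd : ∀ o, S.dir₁ o ≠ S.dir₂ o)
    (hc : ∀ K o, S.corner K (σ o) = reflCorner ρ (S.corner K o) (S.dir₁ o) (S.dir₂ o) (S.sideA K o) (S.sideB K o))
    (h₁ : ∀ o, S.dir₁ (σ o) = S.dir₁ o) (h₂ : ∀ o, S.dir₂ (σ o) = S.dir₂ o) (hA : ∀ K o, S.sideA K (σ o) = S.sideA K o)
    (hB : ∀ K o, S.sideB K (σ o) = S.sideB K o) (K : ℕ) (os : List O) :
    (S.toTorusScheme G).expectAt K (os.map σ) = (S.toTorusScheme G).expectAt K os :=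
  (S.toTorusScheme G).expectAt_map_eq_of_reflect σ (fun K => ⟨ρ, fun o => by
    funext U
    show wilsonLoop U (S.loop K (σ o)) = wilsonLoop (U.reflect ρ) (S.loop K o)
    rw [loop, loop, hc, h₁, h₂, hA, hB]
    exact (wilsonLoop_reflect_rectLoop (P := params4 S.L S.hL S.m K) ρ U _ (hd o) _ _).symm⟩) K os

/-- … hence **every continuum-limit point of such a scheme is invariant under `σ`** (inherited reflection symmetry). [cite: Douglas2004ClayYM, p.2] -/
theorem limit_reflect_invariant [MeasurableInv G] (S : RectLoopScheme O) (σ : O → O) (ρ : Fin 4)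
    (hd : ∀ o, S.dir₁ o ≠ S.dir₂ o)
    (hc : ∀ K o, S.corner K (σ o) = reflCorner ρ (S.corner K o) (S.dir₁ o) (S.dir₂ o) (S.sideA K o) (S.sideB K o))
    (h₁ : ∀ o, S.dir₁ (σ o) = S.dir₁ o) (h₂ : ∀ o, S.dir₂ (σ o) = S.dir₂ o) (hA : ∀ K o, S.sideA K (σ o) = S.sideA K o)
    (hB : ∀ K o, S.sideB K (σ o) = S.sideB K o) {φ : ℕ → ℕ} {E : List O → ℝ}
    (hE : IsLimitFunctional (fun K => (S.toTorusScheme G).expectAt (φ K)) E) (os : List O) : E (os.map σ) = E os :=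
  hE.map_invariant σ (fun K os' => expectAt_map_eq_of_reflect G S σ ρ hd hc h₁ h₂ hA hB (φ K) os') os

/-! ### Non-vacuity: closing a rectangle scheme under a permutation / a reflection -/

/-- The scheme of all `π`-ITERATES of the rectangles of `S`: label `(o, n)` is the rectangle `πⁿ·R_o` (corner `πⁿ·x`, directions
`πⁿ μ, πⁿ ν`, same sides and physical lengths). [folklore] -/
def permutes (S : RectLoopScheme O) (π : Equiv.Perm (Fin 4)) : RectLoopScheme (O × ℕ) where
  L := S.L
  hL := S.hL
  m := S.m
  β := S.β
  corner K on := (S.corner K on.1).permute (π ^ on.2)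
  dir₁ on := (π ^ on.2) (S.dir₁ on.1)
  dir₂ on := (π ^ on.2) (S.dir₂ on.1)
  sideA K on := S.sideA K on.1
  sideB K on := S.sideB K on.1
  R on := S.R on.1
  T on := S.T on.1
  sideA_tendsto on := S.sideA_tendsto on.1
  sideB_tendsto on := S.sideB_tendsto on.1

/-- In `S.permutes π` the shift `(o, n) ↦ (o, n+1)` acts on the data as the coordinate permutation `π`, so every continuum-limit
point of its joint expectations is shift invariant. [folklore] -/
theorem permutes_limit_shift_invariant (S : RectLoopScheme O) (π : Equiv.Perm (Fin 4)) {φ : ℕ → ℕ}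
    {E : List (O × ℕ) → ℝ} (hE : IsLimitFunctional (fun K => ((S.permutes π).toTorusScheme G).expectAt (φ K)) E)
    (os : List (O × ℕ)) : E (os.map fun on => (on.1, on.2 + 1)) = E os :=
  limit_permute_invariant G (S.permutes π) (fun on => (on.1, on.2 + 1)) π
    (fun K on => by
      simp only [permutes, pow_succ']
      exact Site.permute_mul _ _ _)
    (fun on => by simp only [permutes, pow_succ', Equiv.Perm.mul_apply])
    (fun on => by simp only [permutes, pow_succ', Equiv.Perm.mul_apply])
    (fun _ _ => rfl) (fun _ _ => rfl) hE os

/-- The scheme of the rectangles of `S` TOGETHER WITH their `r_ρ`-reflections (labels `O ⊕ O`). [folklore] -/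
def withReflected (S : RectLoopScheme O) (ρ : Fin 4) : RectLoopScheme (O ⊕ O) where
  L := S.L
  hL := S.hL
  m := S.m
  β := S.β
  corner K := fun
    | Sum.inl o => S.corner K o
    | Sum.inr o => reflCorner ρ (S.corner K o) (S.dir₁ o) (S.dir₂ o) (S.sideA K o) (S.sideB K o)
  dir₁ l := S.dir₁ (Sum.elim _root_.id _root_.id l)
  dir₂ l := S.dir₂ (Sum.elim _root_.id _root_.id l)
  sideA K l := S.sideA K (Sum.elim _root_.id _root_.id l)
  sideB K l := S.sideB K (Sum.elim _root_.id _root_.id l)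
  R l := S.R (Sum.elim _root_.id _root_.id l)
  T l := S.T (Sum.elim _root_.id _root_.id l)
  sideA_tendsto _ := S.sideA_tendsto _
  sideB_tendsto _ := S.sideB_tendsto _

/-- In `S.withReflected ρ` (non-degenerate rectangles) the swap of labels acts as the reflection `r_ρ`, so every continuum-limit
point of the joint expectations of the rectangles and their reflections is swap invariant. [folklore] -/
theorem withReflected_limit_swap_invariant [MeasurableInv G] (S : RectLoopScheme O) (ρ : Fin 4)
    (hd : ∀ o, S.dir₁ o ≠ S.dir₂ o) {φ : ℕ → ℕ} {E : List (O ⊕ O) → ℝ}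
    (hE : IsLimitFunctional (fun K => ((S.withReflected ρ).toTorusScheme G).expectAt (φ K)) E) (os : List (O ⊕ O)) :
    E (os.map Sum.swap) = E os :=
  limit_reflect_invariant G (S.withReflected ρ) Sum.swap ρ
    (fun l => by cases l <;> exact hd _)
    (fun K l => by
      cases l with
      | inl o => rfl
      | inr o => exact (reflCorner_reflCorner ρ (S.corner K o) (S.dir₁ o) (S.dir₂ o) (S.sideA K o) (S.sideB K o)).symm)
    (fun l => by cases l <;> rfl) (fun l => by cases l <;> rfl) (fun K l => by cases l <;> rfl)
    (fun K l => by cases l <;> rfl) hE os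

end RectLoopScheme

/-! ## 8. (v1.2) Eventual forms: a symmetry realised at all LARGE `K` suffices

The `limit_*_invariant` theorems of §5/§7 and `TorusLimitAxioms.TorusScheme.limit_translate_invariant` take the relabelling
to be realised by an exact symmetry at EVERY step `K` (`hσ : ∀ K, …`).  For the census prose ("isometries of the flat torus
that act compatibly on the lattice observables at every large `K`", e.g. a translation by an `L`-adic vector, which lies in
`ε_K ℤ⁴` only from some `K` on) the EVENTUAL hypothesis `∀ᶠ K in atTop, …` is the right one, and it suffices because a
limit is insensitive to finitely many terms (`Filter.Tendsto.congr'`); along a subsequence `φ` one needs `φ K → ∞`, which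
holds for the strictly increasing `φ` of every limit point (`StrictMono.tendsto_atTop`).  [folklore] bookkeeping; answers the
cell referee's precision item G-ref2-8 (b). -/

section Eventually

variable {G : Type*} [GaugeGroup G] [MeasurableSpace G] [HaarData G] {O : Type*}

/-- **Closed condition, eventual form**: if relabelling by `σ` leaves `Eseq K` unchanged for all LARGE `K`, it leaves the
limit unchanged. [folklore] -/
theorem IsLimitFunctional.map_invariant_of_eventually {Eseq : ℕ → List O → ℝ} {E : List O → ℝ}
    (h : IsLimitFunctional Eseq E) (σ : O → O) (hσ : ∀ᶠ K in atTop, ∀ os, Eseq K (os.map σ) = Eseq K os)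
    (os : List O) : E (os.map σ) = E os :=
  tendsto_nhds_unique (h (os.map σ)) ((h os).congr' (hσ.mono fun _ hK => (hK os).symm))

/-- Single-step form of `TorusScheme.expectAt_map_eq_of_symmetry`: a relabelling realised AT STEP `K` by an exact symmetry of
the `K`-th approximation changes no joint expectation at step `K`. [folklore] -/
theorem TorusScheme.expectAt_map_eq_of_symmetry_at (S : TorusScheme G O) (σ : O → O) (K : ℕ)
    (hσ : ∃ Φ : GaugeField (S.P K) 0 G → GaugeField (S.P K) 0 G,
      IsExpectSymmetry (S.P K) (S.β K) Φ ∧ ∀ o, S.obs K (σ o) = fun U => S.obs K o (Φ U))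
    (os : List O) : S.expectAt K (os.map σ) = S.expectAt K os := by
  obtain ⟨Φ, hΦ, ho⟩ := hσ
  unfold TorusScheme.expectAt
  have h : (fun U : GaugeField (S.P K) 0 G => ((os.map σ).map fun o => S.obs K o U).prod) =
      fun U => (fun V => (os.map fun o => S.obs K o V).prod) (Φ U) := by
    funext U
    simp only [List.map_map, Function.comp_def, ho]
  rw [h]
  exact hΦ (fun V => (os.map fun o => S.obs K o V).prod)

/-- **Every continuum-limit point is invariant under a relabelling realised by exact symmetries at all LARGE `K`.**
(`φ` = the subsequence along which the limit point is taken; strictly increasing, hence `φ K → ∞`.) [cite: Douglas2004ClayYM, p.2] -/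
theorem TorusScheme.limit_symmetry_invariant_of_eventually (S : TorusScheme G O) (σ : O → O)
    (hσ : ∀ᶠ K in atTop, ∃ Φ : GaugeField (S.P K) 0 G → GaugeField (S.P K) 0 G,
      IsExpectSymmetry (S.P K) (S.β K) Φ ∧ ∀ o, S.obs K (σ o) = fun U => S.obs K o (Φ U))
    {φ : ℕ → ℕ} (hφ : StrictMono φ) {E : List O → ℝ} (hE : IsLimitFunctional (fun K => S.expectAt (φ K)) E)
    (os : List O) : E (os.map σ) = E os :=
  hE.map_invariant_of_eventually σ
    ((hφ.tendsto_atTop.eventually hσ).mono fun K hK os' => S.expectAt_map_eq_of_symmetry_at σ (φ K) hK os') os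

/-- Eventual form of `TorusLimitAxioms.TorusScheme.limit_translate_invariant`: lattice translations realised at all large `K`
(e.g. the translation of the torus by an `L`-adic vector). [cite: Douglas2004ClayYM, p.2] -/
theorem TorusScheme.limit_translate_invariant_of_eventually (S : TorusScheme G O) (σ : O → O)
    (hσ : ∀ᶠ K in atTop, ∃ a : Site (S.P K) 0, ∀ o, S.obs K (σ o) = fun U => S.obs K o (U.translate a))
    {φ : ℕ → ℕ} (hφ : StrictMono φ) {E : List O → ℝ} (hE : IsLimitFunctional (fun K => S.expectAt (φ K)) E)
    (os : List O) : E (os.map σ) = E os :=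
  S.limit_symmetry_invariant_of_eventually σ
    (hσ.mono fun _ ⟨a, ha⟩ => ⟨_, IsExpectSymmetry.translate a, ha⟩) hφ hE os

/-- Eventual form of `TorusScheme.limit_permute_invariant` (coordinate permutations realised at all large `K`). [cite: Douglas2004ClayYM, p.2] -/
theorem TorusScheme.limit_permute_invariant_of_eventually (S : TorusScheme G O) (σ : O → O)
    (hσ : ∀ᶠ K in atTop, ∃ π : Equiv.Perm (Fin (S.P K).d), ∀ o, S.obs K (σ o) = fun U => S.obs K o (U.permute π))
    {φ : ℕ → ℕ} (hφ : StrictMono φ) {E : List O → ℝ} (hE : IsLimitFunctional (fun K => S.expectAt (φ K)) E)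
    (os : List O) : E (os.map σ) = E os :=
  S.limit_symmetry_invariant_of_eventually σ
    (hσ.mono fun _ ⟨π, hπ⟩ => ⟨_, IsExpectSymmetry.permute π, hπ⟩) hφ hE os

/-- Eventual form of `TorusScheme.limit_reflect_invariant` (axis reflections realised at all large `K`). [cite: Douglas2004ClayYM, p.2] -/
theorem TorusScheme.limit_reflect_invariant_of_eventually [MeasurableInv G] (S : TorusScheme G O) (σ : O → O)
    (hσ : ∀ᶠ K in atTop, ∃ μ : Fin (S.P K).d, ∀ o, S.obs K (σ o) = fun U => S.obs K o (U.reflect μ))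
    {φ : ℕ → ℕ} (hφ : StrictMono φ) {E : List O → ℝ} (hE : IsLimitFunctional (fun K => S.expectAt (φ K)) E)
    (os : List O) : E (os.map σ) = E os :=
  S.limit_symmetry_invariant_of_eventually σ
    (hσ.mono fun _ ⟨μ, hμ⟩ => ⟨_, IsExpectSymmetry.reflect μ, hμ⟩) hφ hE os

end Eventually

/-! ## 9. (v1.3) Restoration THROUGH UNIQUENESS ACROSS TWO SCHEMES — the one printed mechanism, as bookkeeping

For an isometry that NO lattice approximation realises (a rotation outside `B₄`, a generic translation) §5/§8 give nothing: there
is no hypothesis to feed.  The one mechanism in print, in the Bałaban school (abelian Higgs model, d = 2, 3), is C. King, *The U(1)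
Higgs model. II. The infinite volume limit*, Commun. Math. Phys. **103** (1986) 323–349 [King1986InfiniteVolume], p. 326: "The
properties we have listed in Theorem 2.3 are a subset of the Osterwalder-Schrader axioms presented in [GJ 1]. To complete the list,
we would need to prove ergodicity, rotation invariance and regularity." … "In order to prove rotation invariance, it is sufficient to
show that the limit ⟨Θ(zg,wh)⟩ is the same when constructed from two sequences of lattices whose orientations differ by an angle θ₀
incommensurate with 2π." — realised there by Theorem 2.4 (p. 327): the `K → ∞` limits built from the lattices of spacing
`ε_K = L^{-K}`, `L = 5`, and from the lattices of spacing `5ε_K` rotated by `θ₀ = tan⁻¹(3/4)` (both fitting one torus) coincide;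
"Also, θ₀/2π is irrational."  The BOOKKEEPING content, typed below for two arbitrary families of approximants `Eseq`, `Eseq'` of
functionals on strings of labels: if the second family computes on the relabelled strings `os.map σ` the same numbers as the
first computes on `os` (a COMPARISON identity, exact at every — or every large — step; for King: the rotated lattice's
expectation of the rotated observable IS the unrotated lattice's expectation of the observable), then the comparison passes to
the limits (`map_eq_of_comparison`: `E' (os.map σ) = E os`), so that `σ`-invariance of `E` is EQUIVALENT to the agreement of the
two limits on the `σ`-images (`map_invariant_iff_agree_of_comparison`) and follows from UNIQUENESS ACROSS THE TWO SCHEMES `E' = E`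
(`map_invariant_of_comparison`) — a statement strictly stronger than `Missing.HasContinuumLimit` of one scheme, and the open
analytic content of restoration (the cell contract's word) in this form.  Nothing of King's analysis (his Thm 2.4) is reproduced; [folklore] limits only;
census pointer MISSING.md §C2 (v4.7). -/

section Comparison

variable {G : Type*} [GaugeGroup G] [MeasurableSpace G] [HaarData G] {O : Type*}

/-- Limits of one family of functionals are unique (so "the" limit functional of a scheme along the full sequence is well defined
when it exists). [folklore] -/
theorem IsLimitFunctional.unique {Eseq : ℕ → List O → ℝ} {E E' : List O → ℝ} (h : IsLimitFunctional Eseq E)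
    (h' : IsLimitFunctional Eseq E') : E' = E :=
  funext fun os => tendsto_nhds_unique (h' os) (h os)

/-- **A comparison identity between two families of approximants passes to their limits**: if `Eseq' K (os.map σ) = Eseq K os`
for all large `K`, then `E' (os.map σ) = E os`. [folklore] -/
theorem IsLimitFunctional.map_eq_of_comparison {Eseq Eseq' : ℕ → List O → ℝ} {E E' : List O → ℝ}
    (h : IsLimitFunctional Eseq E) (h' : IsLimitFunctional Eseq' E') (σ : O → O)
    (hσ : ∀ᶠ K in atTop, ∀ os, Eseq' K (os.map σ) = Eseq K os) (os : List O) : E' (os.map σ) = E os :=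
  tendsto_nhds_unique (h' (os.map σ)) ((h os).congr' (hσ.mono fun _ hK => (hK os).symm))

/-- **King's mechanism** [King1986InfiniteVolume, p. 326]: comparison identity + UNIQUENESS ACROSS THE TWO SCHEMES (`E' = E`) ⇒ the
common limit is `σ`-invariant. [cite: King1986InfiniteVolume, p.326] -/
theorem IsLimitFunctional.map_invariant_of_comparison {Eseq Eseq' : ℕ → List O → ℝ} {E E' : List O → ℝ}
    (h : IsLimitFunctional Eseq E) (h' : IsLimitFunctional Eseq' E') (σ : O → O)
    (hσ : ∀ᶠ K in atTop, ∀ os, Eseq' K (os.map σ) = Eseq K os) (hU : E' = E) (os : List O) :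
    E (os.map σ) = E os := by
  have h1 := h.map_eq_of_comparison h' σ hσ os
  rwa [hU] at h1

/-- … and conversely `σ`-invariance of `E` forces the two limits to AGREE ON THE `σ`-IMAGES; so, given the comparison identity,
restoration of `σ` for `E` is EXACTLY uniqueness across the two schemes restricted to the image strings. [folklore] -/
theorem IsLimitFunctional.map_invariant_iff_agree_of_comparison {Eseq Eseq' : ℕ → List O → ℝ} {E E' : List O → ℝ}
    (h : IsLimitFunctional Eseq E) (h' : IsLimitFunctional Eseq' E') (σ : O → O)
    (hσ : ∀ᶠ K in atTop, ∀ os, Eseq' K (os.map σ) = Eseq K os) :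
    (∀ os : List O, E (os.map σ) = E os) ↔ ∀ os : List O, E' (os.map σ) = E (os.map σ) := by
  constructor
  · intro hinv os
    rw [h.map_eq_of_comparison h' σ hσ os, hinv os]
  · intro hagree os
    rw [← hagree os, h.map_eq_of_comparison h' σ hσ os]

/-- Scheme level: two torus schemes `S`, `S'` on the same labels (e.g. a lattice family and a second lattice family on which the
image observables `σ o` are computed — for King, the rotated lattices), a comparison identity of their joint expectations at all
large `K`, and full continuum limits `E`, `E'` of both: the comparison passes to the limits. [folklore] -/
theorem TorusScheme.limit_map_eq_of_comparison (S S' : TorusScheme G O) (σ : O → O)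
    (hσ : ∀ᶠ K in atTop, ∀ os, S'.expectAt K (os.map σ) = S.expectAt K os) {E E' : List O → ℝ}
    (hE : IsLimitFunctional S.expectAt E) (hE' : IsLimitFunctional S'.expectAt E') (os : List O) :
    E' (os.map σ) = E os :=
  hE.map_eq_of_comparison hE' σ hσ os

/-- Scheme level, **restoration through uniqueness across schemes**: if moreover the two schemes have THE SAME continuum limit
(`E' = E` — the open statement; King's Thm 2.4 in his model), that limit is `σ`-invariant. [cite: King1986InfiniteVolume, p.326] -/
theorem TorusScheme.limit_map_invariant_of_comparison (S S' : TorusScheme G O) (σ : O → O)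
    (hσ : ∀ᶠ K in atTop, ∀ os, S'.expectAt K (os.map σ) = S.expectAt K os) {E E' : List O → ℝ}
    (hE : IsLimitFunctional S.expectAt E) (hE' : IsLimitFunctional S'.expectAt E') (hU : E' = E) (os : List O) :
    E (os.map σ) = E os :=
  hE.map_invariant_of_comparison hE' σ hσ hU os

/-- Degenerate instance (consistency with §8, and non-vacuity of the hypotheses): when `σ` IS realised by exact lattice
symmetries at all large `K`, the scheme compares WITH ITSELF (`S' = S`), uniqueness across the "two" schemes is uniqueness of
limits, and one recovers invariance of the full continuum limit. [folklore] -/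
theorem TorusScheme.limit_map_invariant_of_self_comparison (S : TorusScheme G O) (σ : O → O)
    (hσ : ∀ᶠ K in atTop, ∃ Φ : GaugeField (S.P K) 0 G → GaugeField (S.P K) 0 G,
      IsExpectSymmetry (S.P K) (S.β K) Φ ∧ ∀ o, S.obs K (σ o) = fun U => S.obs K o (Φ U))
    {E : List O → ℝ} (hE : IsLimitFunctional S.expectAt E) (os : List O) : E (os.map σ) = E os :=
  S.limit_map_invariant_of_comparison S σ
    (hσ.mono fun K hK os' => S.expectAt_map_eq_of_symmetry_at σ K hK os') hE hE rfl os

end Comparison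

end Missing

end Literature.MathematicalPhysics.QuantumFieldTheory.Balaban1983to89

end
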